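import Literature.MathematicalPhysics.QuantumFieldTheory.Balaban1983to89.B4Green242Bridge
import Literature.MathematicalPhysics.QuantumFieldTheory.Balaban1983to89.B4Sect5Torus
import Literature.MathematicalPhysics.QuantumFieldTheory.Balaban1983to89.Beta.CoordCubePoincare

/-!
# `Balaban1983to89.B4BoxCov237` — B4 Lemma 2.4, third quantity (2.37), `|C^{(j)}(□; y, y′)| ≤ c₀e^{−δ₀|y−y′|}`,
Proposition 2.3 (1.15) for `Ω = □`, (v2, §8) Proposition 2.3 (1.16) for `Ω = □` and EVERY `Λ ⊆ □^{(j)}`, and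
(v3, §9) (1.17)–(1.18), the decay of `δC_Λ^{(j)}(□) = C_Λ^{(j)}(□) − C^{(j)}(□)` with the distances to `Λᶜ`: the
fluctuation covariance of a Neumann box with `A = 0`, HYPOTHESIS-FREE (a sibling of `B4Green242Bridge`; no existing
module is touched; nothing of B4 is asserted; v2, v3 are append-only over v1, v2 in their declarations)

Source under audit (cell pub-balaban): T. Bałaban, *Regularity and decay of lattice Green's functions*, Commun. Math.
Phys. **89** (1983) 571–597 [`Balaban1983RegularityDecay`, "B4"], p. 582 [PDF 12] Lemma 2.4 (2.37), p. 584 [PDF 14]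
(first paragraph of the proof of Lemma 2.4, and (2.44)), p. 572 [PDF 2] (1.1), (1.3)–(1.6), p. 573 [PDF 3] (1.13)–(1.14),
p. 574 [PDF 4] Proposition 2.3 (1.15)–(1.16) and (1.17)–(1.18) (journal page = PDF page + 570; renders
`b2b-balaban-ref1/pages/1983-cmp89-regularity-decay/1983-cmp89-regularity-decay-p012-x2.png`, `-p014-x2.png`,
`-p002-x2.png`, `-p003-x2.png`, `-p004-x2.png`, read as images).

## WHAT IS PRINTED (verbatim; `≦` of the print written `≤`)

p. 582: «Lemma 2.4. There exist positive constants c₀, δ₀, and for α<1, there exists a constant c₁, such that …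
|C^{(j)}(□; y, y′)| ≤ c₀e^{−δ₀|y−y′|},   (2.37)
for arbitrary non-negative integer j, arbitrary, rectangular parallelepiped □ ⊂ L^{−j}Z^d built of large blocks, and
x, x′ ∈ □, y, y′ ∈ □^{(j)} = □∩Z^d.»

p. 584: «Proof of Lemma 2.4. At first let us notice that the inequality (2.37) concerning C^{(j)}(□) is a special case
of Proposition 2.3. The proof of this proposition will be given in the next section and is based on Corollary 2.3
only. Thus we can assume that (2.37) is proved.» … «We apply it to the basic equation
(−Δ^ξ + m_j² + a_jQ_j^*Q_j)φ₀ = f.   (2.44)  Defining the propagator G_j, φ₀ = G_jf, we get …».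

p. 572: «The lattice ηZ^d is divided into unit cubes called blocks and parametrized by points y of the unit lattice
Z^d: B^k(y) = Δ(y) = {x∈ηZ^d : y_μ ≤ x_μ < y_μ + 1, μ = 1, …, d},  y∈Z^d.   (1.1)» … «⟨φ,(−Δ^{η,N}_{A,Ω})φ⟩ =
Σ_{b⊂Ω} η^d|(D^η_Aφ)(b)|² = Σ_{b⊂Ω} η^d|η^{−1}(U(A_b)φ(b₊) − φ(b₋))|²,   (1.3)  where the summation is over the set of
all bonds b = ⟨b₋, b₊⟩ with end-points b₋, b₊ in Ω.» … «(Q_k(A)φ)(y) = Σ_{x∈B^k(y)} η^dU(A(Γ^{(k)}_{y,x}))φ(x),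
y∈Z^d.   (1.4)» … «The projection operator P_k(A) is given by P_k(A) = Q_k^*(A)Q_k(A).   (1.5)  Our fundamental
Green's function is a kernel of the operator G_k(Ω, A) = (−Δ^{η,N}_{A,Ω} + m² + aP_k(A))^{−1},   (1.6)  where m² ≥ 0
and a is a positive constant close to 1.»

p. 573: «Let us recall that for operators X defined on the unit lattice functions we define the operator X|_Λ
restricted to a subset Λ by X|_Λ = ΛXΛ, where Λ also denotes the characteristic function of the set Λ. We have
C_Λ^{(k)}(Ω, A) = ((Δ^{(k)}(Ω, A) + aL^{−2}P(A))|_Λ)^{−1}.   (1.13)  Here Δ^{(k)}(Ω, A) is an operator of the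
effective Gaussian action after k renormalization transformations and can be defined by
Δ^{(k)}(Ω, A) = a_kI − a_k²Q_k(A)G_k(Ω, A)Q_k^*(A),   (1.14)  where a_k is a constant proportional to a.»

p. 574: «Proposition 2.3 of [1]. There exist positive constants δ₀, c₀, γ₀, γ₁ dependent on d and M only and such
that for arbitrary Λ ⊂ Ω^{(k)} = Ω∩Z^d, Λ being a sum of big blocks and for e sufficiently small, we have
γ₀I ≤ Δ^{(k)}(Ω, A) + aL^{−2}P(A) ≤ γ₁I,   (1.15)
|C_Λ^{(k)}(Ω, A; x, x′)| ≤ c₀ exp(−δ₀|x−x′|),  x, x′∈Λ.   (1.16)»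
«In particular the above inequality holds for C^{(k)}(Ω, A). Putting
δC_Λ^{(k)}(Ω, A) = C_Λ^{(k)}(Ω, A) − C^{(k)}(Ω, A),   (1.17)
we have also
|δC_Λ^{(k)}(Ω, A; x, x′)| ≤ c₀ exp(−δ₀(|x−x′| + dist(x, Λ^c) + dist(x′, Λ^c))),  x, x′∈Λ.   (1.18)»

## WHAT THIS FILE CERTIFIES (kernel-checked, no hypotheses; the lineage is USED, not re-proved)

For the gauge field `A = 0` (so `U ≡ 1`; the case of Sect. 2 of the paper), spatial dimension `d + 1`, block size
`L = ℓ + 1 ≥ 2`, and the parameter window `a_j ∈ [a₋, a₊]` (`a₋ > 0`), `m_j² ∈ [0, m²₊]`, `a ∈ [a₂₋, a₂₊]`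
(`a₂₋ > 0`): there are `δ, c > 0` and `0 < γ₀ ≤ γ₁` such that for EVERY `n ≥ 1` (in the paper `n = L^j`, `ξ = 1/n`),
EVERY box of unit side lengths `L·M′_μ` (`M′_μ ≥ 1`) — fine box `X = Π_μ[0, nLM′_μ) ⊂ ℤ^{d+1}` (`= ξ^{-1}□`), unit box
`□^{(j)} = Π_μ[0, LM′_μ) ∩ ℤ^{d+1}` — the typed `C^{(j)}(□)^{-1} = covOp n ℓ a_j a m_j² M′` satisfies
* `cov237_box_form_bounds`: `γ₀‖ω‖² ≤ ⟨ω, (Δ^{(j)}(□) + aL^{-2}P)ω⟩ ≤ γ₁‖ω‖²` — (1.15) for `Ω = □`, `Λ = □^{(j)}`;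
* `cov237_box_decay`: `Δ^{(j)}(□) + aL^{-2}P` is invertible (`covOp_mul_inv`, so `⁻¹` is the genuine inverse) and
  `|C^{(j)}(□; y, y′)| ≤ c·e^{−δ|y − y′|_∞}` for all `y, y′ ∈ □^{(j)}` — (2.37) = (1.16) for `Ω = □`, `Λ = □^{(j)}`
  (sup norm; the Euclidean form follows with `δ/√(d+1)`);
* (v2, §8) `cov116_box_sub_decay` / `cov116_box_finset_decay`: for EVERY injection `e : m → □^{(j)}` (every subset
  `Λ ⊆ □^{(j)}`, `e` = the inclusion) the compression `(Δ^{(j)}(□) + aL^{-2}P)|_Λ = Λ(Δ^{(j)}(□) + aL^{-2}P)Λ`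
  (`covOpSub`, the operator inverted in (1.13)) is invertible and `|C_Λ^{(j)}(□; y, y′)| ≤ c·e^{−δ|y − y′|_∞}` for all
  `y, y′ ∈ Λ` with the SAME `δ, c` — (1.16) for `Ω = □` and arbitrary `Λ`; at `A = 0` the proviso «Λ being a sum of
  big blocks» is not needed (nothing is claimed about `A ≠ 0`), and `γ₀‖v‖² ≤ ⟨v, (Δ^{(j)}(□) + aL^{-2}P)|_Λ v⟩`
  (`covOpSub_form_ge`);
* (v3, §9) `cov118_box_sub_delta` / `cov118_box_finset_delta`: there are `δ′, c′ > 0` (window-uniform) such that for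
  every injection `e` with range `Λ` and every weight `β ≥ 0` on `Λ` dominated by the sup-distances to the points of
  `□^{(j)} ∖ Λ` (e.g. `β = dist_∞(·, □^{(j)} ∖ Λ)`, typed `distC`):
  `|C_Λ^{(j)}(□; y, y′) − C^{(j)}(□; y, y′)| ≤ c′·e^{−δ′(|y − y′|_∞ + β(y) + β(y′))}` for all `y, y′ ∈ Λ` — (1.17)–(1.18)
  for `Ω = □`, `A = 0`, arbitrary `Λ`, with `Λᶜ` read as the complement inside `□^{(j)}`.
The proof is the typist's (elementary; the paper proves Proposition 2.3 in its Sect. 3 by a different route):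
(i) `Δ^{(j)}(□) = a_jI − a_j²Q_jG_j(□)Q_j^*` is a Schur complement, whence the energy identity
`⟨ψ, Δ^{(j)}ψ⟩ = a_j‖ψ − Q_jg⋆‖² + ⟨g⋆, (−Δ^ξ_□ + m_j²)g⋆⟩_ξ`, `g⋆ = a_jG_j(□)Q_j^*ψ` (`Keff_form_eq_energy`), and the
bound `⟨ψ, Δ^{(j)}ψ⟩ ≤ a_j‖ψ‖²` (`Keff_form_le`); (ii) the unit-lattice Dirichlet form of a block average is controlled
by the fine Dirichlet form (telescoping + Cauchy–Schwarz, `dirBox_blockSum_le`), whence the basic lower bound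
`⟨ψ, Δ^{(j)}(□)ψ⟩ ≥ min(a_j/(8(d+1)), 1/8)·Σ_{⟨y,y′⟩⊂□^{(j)}}(ψ(y) − ψ(y′))²` uniformly in `j` (`Keff_form_ge`); (iii) the
Poincaré inequality on every `L`-block (`Beta.CoordCubePoincare.blockPoincare_of_charts`) and
`Beta.BlockPoincare.coercive_of_blockPoincare` give `γ₀ = min(min(a₋/(8(d+1)), 1/8)/(ℓ(ℓ+1)/2), a₂₋/L²)`
(`covOp_form_ge`); (iv) the entries of `Δ^{(j)}(□) + aL^{-2}P` decay at the rate `κ` of the lineage's hypothesis-free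
first estimate of (2.35) for `G_j(□)Q_j^*` (`B4Green242Bridge.greenBoxQ_decay_235_inv`, via the block–block sums of
`G_j(□)`; `P` has range `ℓ`) (`Keff_entry_bound`, `blockAvgP_entry_bound`); (v) the finite Combes–Thomas estimate of the
paper's Sect. 5 as typed in `B4Sect5Torus.inv_decay` ((5.6) ⇒ (5.7)) with the uniform lattice-sum profile
`B4Sect5Proof.latticeSum_le` gives the decay of the inverse with `δ = rate K γ₀ c₀ κ`, `c = 2/γ₀`; (vi) condition
(5.6) passes to every compression along an injection with the same constants (`B4Sect5Torus.hyp56_submatrix`: the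
form bound is tested on extensions by zero, the kernel bound restricts), so (v) applies to `(Δ^{(j)}(□) + aL^{-2}P)|_Λ`
verbatim (`B4Sect5Torus.inv_submatrix_decay`) — §8; (vii) the block-resolvent identity
`A_Λ⁻¹ − A⁻¹|_Λ = A_Λ⁻¹·(ΛAΛᶜ)·A⁻¹|_{Λᶜ×Λ}` and its decay under (5.6) (`B4Sect5Torus.deltaC_eq`, `deltaC_bound`, the
paper's (5.8) in exact block algebra) give (1.18) with `δ′ = rate(K, γ₀, c₀+1, κ)/4` — §9.

## DICTIONARY (typist's; each line is a reading, not a quotation)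

* `ξ = L^{−j} = 1/n`; fine point `x ∈ X = boxDom (nLM′)` ↔ `ξx ∈ □`; unit point `y ∈ boxDom (LM′)` ↔ `y ∈ □^{(j)}`;
  `B^j(y) ∩ □` ↔ `{x : blk n x = y}` (`n^{d+1}` points, (1.1)); `L`-block of `y` ↔ `blk L y ∈ boxDom M′`.
* `G_j(□)` ↔ `(boxOpR n a_j m_j² (LM′))⁻¹`, `boxOpR = n²(−Δ^N_X) + m_j² + (a_j/n^{d+1})·1_{same n-block}` = the matrix of
  `−Δ^ξ_□ + m_j² + a_jQ_j^*Q_j` ((1.3)–(1.6) with Neumann b.c. on `□`, (2.44) for the scale-`j` coefficients) acting on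
  functions of the fine points (`B4Green242Bridge.boxOp` is its complex cast, `boxOp_eq_map`; the lineage's typing of
  (2.42)/(2.44)); `Q_jG_j(□)Q_j^*` ↔ `n^{-(d+1)}·indB·(boxOpR)⁻¹·indBᵀ` (`Q_j` = `ξ^{d+1}`-weighted block sum (1.4),
  `Q_j^*` = piecewise-constant extension).
* `Δ^{(j)}(□)` (1.14) ↔ `Keff n a_j m_j² (LM′) = a_j•1 − (a_j²/n^{d+1})•(indB·(boxOpR)⁻¹·indBᵀ)`; `P` ((1.13), the
  projection `Q^*Q` of the NEXT step on the unit lattice) ↔ `blockAvgP ℓ M′ (y, y′) = L^{-(d+1)}[blk L y = blk L y′]`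
  (the orthogonal projection onto `L`-block constants in `ℓ²(□^{(j)})`, counting measure);
  `(Δ^{(j)}(□) + aL^{−2}P)|_{□^{(j)}}` ↔ `covOp n ℓ a_j a m_j² M′`; `C^{(j)}(□; y, y′)` ↔ `(covOp …)⁻¹ y y′`.
* (v2) `X|_Λ = ΛXΛ` for `X = Δ^{(j)}(□) + aL^{−2}P`, `Λ ⊆ □^{(j)}` ↔ `covOpSub n ℓ a_j a m_j² M′ e = (covOp …).submatrix e e`
  along an injection `e : m → □^{(j)}` with range `Λ` (the principal submatrix; as an operator on `ℓ²(Λ)`);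
  `C_Λ^{(j)}(□; y, y′)` ((1.13) with `Ω = □`) ↔ `(covOpSub … e)⁻¹ i i′`, `y = e i`, `y′ = e i′`.
* (v3) `δC_Λ^{(j)}(□; y, y′)` (1.17) ↔ `(covOpSub … e)⁻¹ i i′ − (covOp …)⁻¹ (e i) (e i′)`; `dist(x, Λ^c)` ↔ any
  `β : m → ℝ`, `0 ≤ β i ≤ |e i − z|_∞` for all `z ∈ □^{(j)} ∖ Λ` — the largest such, `distC Λ y = inf_{z ∈ □^{(j)} ∖ Λ}
  |y − z|_∞` (`= 0` when `Λ = □^{(j)}`, by `sInf ∅ = 0`), is the sup-distance to the complement INSIDE the unit box.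
* `|y − y′|` ↔ `supNorm (y − y′)` (sup norm of `ℤ^{d+1}`).

## HONEST SCOPE (what is NOT certified)

* `A = 0` only; `Ω = □` a rectangular parallelepiped only (not a general `Ω`); in §1–§7 `Λ = □^{(j)}` is the WHOLE
  unit box, in §8 (v2) `Λ` is an ARBITRARY subset of `□^{(j)}` (the range of an injection) — more than the print's
  «Λ being a sum of big blocks» asks, which is harmless at `A = 0` and is NOT claimed for `A ≠ 0`; (1.15) is certified
  for the operator on `□^{(j)}` (as printed, `Ω = □`) and its lower half for every compression, the upper half of
  (1.15)|_Λ is not typed; the box is anchored at the origin with side lengths multiples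
  of `L` ("built of large blocks" is typed as: a union of `L`-blocks of the block lattice `Lℤ^{d+1}` — the case `L | M`
  of the paper's big blocks of size `M`); the fine box is half-open, `Π[0, nLM′_μ)`, as in the lineage's typing of (2.42).
* (v3) In (1.18) `Λ^c` is read as `□^{(j)} ∖ Λ` (the complement inside `Ω^{(k)} = □^{(j)}`, where the operators
  live); the constants `δ′, c′` of §9 are NOT the `δ, c` of (2.37)/(1.16) (the print uses one pair `c₀, δ₀`
  throughout; only existence is printed and only existence is certified); (1.19)–(1.20) (two regions `Ω ⊂ Ω₀`) are
  NOT typed.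
* The SAME constant `a_j` appears in `G_j(□)` and in `Δ^{(j)}(□)` (as printed in (1.14)/(2.44); this is what makes
  `Δ^{(j)}` a Schur complement); the coefficient `a` of `aL^{−2}P` is an independent parameter `a₂` ranging over a
  window (the print: «a_k is a constant proportional to a»; no relation is used).
* The constants depend on `d`, `ℓ` and the window (the paper: «dependent on d and M only»); no claim is made about their
  size, about `γ₀` being close to the paper's, or about uniformity in `L`.
* Nothing is inferred from the manuscript: every step is kernel-checked from the definitions; the quoted sentences
  locate the statement, they are not used as hypotheses.

Value = kernel certificate of an elementary reading of (2.37)/(1.15) for the Neumann box at `A = 0`; NOT summit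
progress.
-/

namespace Literature.MathematicalPhysics.QuantumFieldTheory.Balaban1983to89.B4BoxCov237

open Finset Matrix
open Literature.MathematicalPhysics.QuantumFieldTheory.Balaban1983to89.B4ContourShift
open Literature.MathematicalPhysics.QuantumFieldTheory.Balaban1983to89.B4Reflection242
open Literature.MathematicalPhysics.QuantumFieldTheory.Balaban1983to89.B4Green242Bridge
open B4Sect5Torus (IsPseudoDist SumBound Hyp56 rate rate_pos inv_decay)
open B4Sect5Proof (latticeConst latticeConst_nonneg latticeSum_le)
open Beta.BlockPoincare (avg coercive_of_blockPoincare blockTerm_eq card_mul_avg_sq_le)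
open Beta.CoordCubePoincare (stepUp blockPoincare_of_charts)

noncomputable section

variable {d : ℕ}

/-! ## §1 The Neumann box operator with real coefficients; dictionary with `B4Green242Bridge.opBox` / `boxOp` -/

/-- the Neumann box operator `c₁(−Δ^N_□) + msq + a·1_{blk · = blk ·}` as a REAL matrix on the box (the complex
`B4Green242Bridge.opBox (c₁:ℂ) (msq:ℂ) (a:ℂ)` is its entrywise cast, `opBox_eq_map`). [folklore] -/
def opBoxR (c₁ msq a : ℝ) (b : ℕ) (N : Fin (d + 1) → ℕ) : Matrix ↥(boxDom N) ↥(boxDom N) ℝ :=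
  Matrix.of fun x y => c₁ * neumannLapK N x.1 y.1 + (diagK msq x.1 y.1 + avgK a b x.1 y.1)

/-- the complex box operator with real coefficients is the entrywise cast of the real one. [folklore] -/
theorem opBox_eq_map (c₁ msq a : ℝ) (b : ℕ) (N : Fin (d + 1) → ℕ) :
    opBox (c₁ : ℂ) (msq : ℂ) (a : ℂ) b N = (opBoxR c₁ msq a b N).map ((↑) : ℝ → ℂ) := by
  ext x y
  simp only [opBox, opBoxR, Matrix.map_apply, Matrix.of_apply, opBoxK, neumannLapK, diagK, avgK]
  split_ifs <;> push_cast <;> ring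

/-- the operator of B4 (2.44) in lattice units, `n²(−Δ^N_X) + m2 + (a/n^{d+1})·1_{same n-block}` on the box
`X = Π[0, n·M_μ)`, as a REAL matrix (`B4Green242Bridge.boxOp` is its cast, `boxOp_eq_map`).
[cite: Balaban1983RegularityDecay, p. 584 (2.44) with p. 572 (1.3)–(1.6), dictionary] [folklore] -/
def boxOpR (n : ℕ) (a m2 : ℝ) (M : Fin (d + 1) → ℕ) :
    Matrix ↥(boxDom (fun i => n * M i)) ↥(boxDom (fun i => n * M i)) ℝ :=
  opBoxR ((n : ℝ) ^ 2) m2 (a * ((n : ℝ) ^ (d + 1))⁻¹) n (fun i => n * M i)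

/-- the lineage's complex box operator `B4Green242Bridge.boxOp` is the entrywise cast of `boxOpR`. [folklore] -/
theorem boxOp_eq_map (n : ℕ) (a m2 : ℝ) (M : Fin (d + 1) → ℕ) :
    boxOp n a m2 M = (boxOpR n a m2 M).map ((↑) : ℝ → ℂ) := by
  have hEq : boxOp n a m2 M = opBox (((n : ℝ) ^ 2 : ℝ) : ℂ) (m2 : ℂ) ((a * ((n : ℝ) ^ (d + 1))⁻¹ : ℝ) : ℂ) n
      (fun i => n * M i) := by
    simp only [boxOp, Complex.ofReal_pow, Complex.ofReal_natCast, Complex.ofReal_mul, Complex.ofReal_inv]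
  rw [hEq, opBox_eq_map]
  rfl

/-- the kernel of the real box operator is symmetric. [folklore] -/
theorem opBoxR_apply_comm (c₁ msq a : ℝ) (b : ℕ) (N : Fin (d + 1) → ℕ) (x y : ↥(boxDom N)) :
    opBoxR c₁ msq a b N x y = opBoxR c₁ msq a b N y x := by
  simp only [opBoxR, Matrix.of_apply, neumannLapK, diagK, avgK]
  by_cases hxy : x = y
  · subst hxy; rfl
  · have h1 : x.1 ≠ y.1 := fun h => hxy (Subtype.ext h)
    have h2 : y.1 ≠ x.1 := fun h => hxy (Subtype.ext h.symm)
    have hn : (y.1 ∈ nbrs x.1) = (x.1 ∈ nbrs y.1) := propext nbrs_comm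
    have hb : (blk b y.1 = blk b x.1) = (blk b x.1 = blk b y.1) := propext eq_comm
    simp only [h1, h2, if_false, hn, hb]

/-- the real box operator (general coefficients) is a symmetric matrix. [folklore] -/
theorem opBoxR_isSymm (c₁ msq a : ℝ) (b : ℕ) (N : Fin (d + 1) → ℕ) : (opBoxR c₁ msq a b N).IsSymm := by
  ext x y
  exact opBoxR_apply_comm c₁ msq a b N y x

/-- the real box operator `boxOpR` is a symmetric matrix. [folklore] -/
theorem boxOpR_isSymm (n : ℕ) (a m2 : ℝ) (M : Fin (d + 1) → ℕ) : (boxOpR n a m2 M).IsSymm :=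
  opBoxR_isSymm _ _ _ _ _

/-- the real box operator is a unit for `c₁ > 0`, `msq ≥ 0`, `a > 0`, `N_μ ≥ 1` (from the complex statement
`opBox_isUnit` by `det(A.map ofReal) = ofReal (det A)`). [folklore] -/
theorem opBoxR_isUnit {c₁ msq a : ℝ} (hc₁ : 0 < c₁) (hmsq : 0 ≤ msq) (ha : 0 < a) (b : ℕ)
    {N : Fin (d + 1) → ℕ} (hN : ∀ i, 1 ≤ N i) : IsUnit (opBoxR c₁ msq a b N) := by
  have h := opBox_isUnit hc₁ hmsq ha b hN
  rw [Matrix.isUnit_iff_isUnit_det] at h ⊢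
  rw [opBox_eq_map] at h
  have hdet : ((opBoxR c₁ msq a b N).map ((↑) : ℝ → ℂ)).det = ((opBoxR c₁ msq a b N).det : ℂ) := by
    have := RingHom.map_det Complex.ofRealHom (opBoxR c₁ msq a b N)
    rw [RingHom.mapMatrix_apply] at this
    exact this.symm
  rw [hdet, isUnit_iff_ne_zero, Complex.ofReal_ne_zero] at h
  exact isUnit_iff_ne_zero.2 h

/-- the real box operator is invertible for `n ≥ 1`, `a > 0`, `m² ≥ 0` (from the lineage's `opBox_isUnit`). [folklore] -/
theorem boxOpR_isUnit {n : ℕ} (hn : 1 ≤ n) {a m2 : ℝ} (ha : 0 < a) (hm : 0 ≤ m2)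
    {M : Fin (d + 1) → ℕ} (hM : ∀ i, 1 ≤ M i) : IsUnit (boxOpR n a m2 M) := by
  have hn' : (0 : ℝ) < n := by exact_mod_cast hn
  refine opBoxR_isUnit (by positivity) hm (by positivity) n fun i => ?_
  exact le_trans hn (Nat.le_mul_of_pos_right n (hM i))

/-- the determinant of the real box operator is a unit. [folklore] -/
theorem boxOpR_det_isUnit {n : ℕ} (hn : 1 ≤ n) {a m2 : ℝ} (ha : 0 < a) (hm : 0 ≤ m2)
    {M : Fin (d + 1) → ℕ} (hM : ∀ i, 1 ≤ M i) : IsUnit (boxOpR n a m2 M).det :=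
  (Matrix.isUnit_iff_isUnit_det _).1 (boxOpR_isUnit hn ha hm hM)

/-- entrywise cast commutes with the inverse of a real unit. [folklore] -/
theorem map_inv_of_isUnit {m : Type*} [Fintype m] [DecidableEq m] {A : Matrix m m ℝ} (hA : IsUnit A) :
    (A.map ((↑) : ℝ → ℂ))⁻¹ = A⁻¹.map ((↑) : ℝ → ℂ) := by
  apply Matrix.inv_eq_right_inv
  have h : A * A⁻¹ = 1 := Matrix.mul_nonsing_inv A ((Matrix.isUnit_iff_isUnit_det A).1 hA)
  have hmul : (A * A⁻¹).map ⇑Complex.ofRealHom = A.map ⇑Complex.ofRealHom * A⁻¹.map ⇑Complex.ofRealHom :=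
    Matrix.map_mul
  change A.map ⇑Complex.ofRealHom * A⁻¹.map ⇑Complex.ofRealHom = 1
  rw [← hmul, h, Matrix.map_one _ (map_zero _) (map_one _)]

/-- **DICTIONARY**: the Green function `G_j(□) = (boxOp)⁻¹` of `B4Green242Bridge` (B4 (2.44), lattice units) is the
cast of the real inverse `(boxOpR)⁻¹`. [folklore] -/
theorem boxOp_inv_eq_map {n : ℕ} (hn : 1 ≤ n) {a m2 : ℝ} (ha : 0 < a) (hm : 0 ≤ m2)
    {M : Fin (d + 1) → ℕ} (hM : ∀ i, 1 ≤ M i) :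
    (boxOp n a m2 M)⁻¹ = ((boxOpR n a m2 M)⁻¹).map ((↑) : ℝ → ℂ) := by
  rw [boxOp_eq_map]
  exact map_inv_of_isUnit (boxOpR_isUnit hn ha hm hM)

/-- `boxOpR · boxOpR⁻¹ = 1`: the nonsingular inverse is a genuine right inverse. [folklore] -/
theorem boxOpR_mul_inv {n : ℕ} (hn : 1 ≤ n) {a m2 : ℝ} (ha : 0 < a) (hm : 0 ≤ m2)
    {M : Fin (d + 1) → ℕ} (hM : ∀ i, 1 ≤ M i) : boxOpR n a m2 M * (boxOpR n a m2 M)⁻¹ = 1 :=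
  Matrix.mul_nonsing_inv _ (boxOpR_det_isUnit hn ha hm hM)

/-- `boxOpR⁻¹ · boxOpR = 1`: the nonsingular inverse is a genuine left inverse. [folklore] -/
theorem boxOpR_inv_mul {n : ℕ} (hn : 1 ≤ n) {a m2 : ℝ} (ha : 0 < a) (hm : 0 ≤ m2)
    {M : Fin (d + 1) → ℕ} (hM : ∀ i, 1 ≤ M i) : (boxOpR n a m2 M)⁻¹ * boxOpR n a m2 M = 1 :=
  Matrix.nonsing_inv_mul _ (boxOpR_det_isUnit hn ha hm hM)

/-- the inverse of the (symmetric) real box operator is symmetric. [folklore] -/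
theorem boxOpR_inv_isSymm (n : ℕ) (a m2 : ℝ) (M : Fin (d + 1) → ℕ) : ((boxOpR n a m2 M)⁻¹).IsSymm := by
  unfold Matrix.IsSymm
  rw [Matrix.transpose_nonsing_inv, (boxOpR_isSymm n a m2 M).eq]

/-! ## §2 The real quadratic form of the box operator -/

/-- the real box operator on a vector: `c₁·Σ_{y ∼ x}(v x − v y) + msq·v x + a·Σ_{blk y = blk x} v y`. [folklore] -/
theorem opBoxR_mulVec (c₁ msq a : ℝ) (b : ℕ) (N : Fin (d + 1) → ℕ) (v : ↥(boxDom N) → ℝ) (x : ↥(boxDom N)) :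
    (opBoxR c₁ msq a b N).mulVec v x
      = c₁ * (∑ y ∈ boxNbrs N x, (v x - v y)) + (msq * v x + a * ∑ y ∈ boxBlk b N x, v y) := by
  classical
  have hL : ∑ y : ↥(boxDom N), neumannLapK N x.1 y.1 * v y = ∑ y ∈ boxNbrs N x, (v x - v y) := by
    have hpt : ∀ y : ↥(boxDom N), (neumannLapK N x.1 y.1 : ℝ) * v y
        = (if y = x then ((boxNbrs N x).card : ℝ) * v x else 0) - (if y ∈ boxNbrs N x then v y else 0) := by
      intro y
      by_cases hyx : y = x
      · subst hyx
        simp [neumannLapK, not_mem_boxNbrs_self, card_boxNbrs]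
      · have hyx' : y.1 ≠ x.1 := fun h => hyx (Subtype.ext h)
        by_cases hyn : y.1 ∈ nbrs x.1
        · have hmem : y ∈ boxNbrs N x := by
            unfold boxNbrs; simp only [Finset.mem_filter, Finset.mem_univ, true_and]; exact hyn
          simp [neumannLapK, hyx, hyx', hyn, hmem]
        · have hmem : y ∉ boxNbrs N x := by
            unfold boxNbrs; simp only [Finset.mem_filter, Finset.mem_univ, true_and]; exact hyn
          simp [neumannLapK, hyx, hyx', hyn, hmem]
    simp_rw [hpt]
    rw [Finset.sum_sub_distrib, Finset.sum_ite_eq' Finset.univ x, if_pos (Finset.mem_univ _),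
      ← Finset.sum_filter, Finset.filter_mem_eq_inter, Finset.univ_inter, Finset.sum_sub_distrib,
      Finset.sum_const, nsmul_eq_mul]
  have hD : ∑ y : ↥(boxDom N), diagK msq x.1 y.1 * v y = msq * v x := by
    have hpt : ∀ y : ↥(boxDom N), (diagK msq x.1 y.1 : ℝ) * v y = if y = x then msq * v x else 0 := by
      intro y
      by_cases hyx : y = x
      · subst hyx; simp [diagK]
      · have hyx' : y.1 ≠ x.1 := fun h => hyx (Subtype.ext h)
        simp [diagK, hyx, hyx']
    simp_rw [hpt]
    rw [Finset.sum_ite_eq' Finset.univ x, if_pos (Finset.mem_univ _)]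
  have hA : ∑ y : ↥(boxDom N), avgK a b x.1 y.1 * v y = a * ∑ y ∈ boxBlk b N x, v y := by
    unfold boxBlk
    rw [Finset.sum_filter, Finset.mul_sum]
    refine Finset.sum_congr rfl fun y _ => ?_
    simp only [avgK]
    split_ifs <;> simp
  have hmv : (opBoxR c₁ msq a b N).mulVec v x
      = ∑ y : ↥(boxDom N), (c₁ * neumannLapK N x.1 y.1 + (diagK msq x.1 y.1 + avgK a b x.1 y.1)) * v y := rfl
  rw [hmv]
  simp only [add_mul, Finset.sum_add_distrib, mul_assoc, ← Finset.mul_sum]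
  rw [hL, hD, hA]

/-- exchanging the two ends of the box bonds in a real double sum. [folklore] -/
theorem sum_boxNbrs_commR {N : Fin (d + 1) → ℕ} (f : ↥(boxDom N) → ↥(boxDom N) → ℝ) :
    ∑ x, ∑ y ∈ boxNbrs N x, f x y = ∑ x, ∑ y ∈ boxNbrs N x, f y x :=
  Finset.sum_comm' fun _ _ =>
    ⟨fun h => ⟨mem_boxNbrs_comm.1 h.2, Finset.mem_univ _⟩, fun h => ⟨Finset.mem_univ _, mem_boxNbrs_comm.1 h.1⟩⟩

/-- the real bond form: `2·Σ_x v x·Σ_{y ∼ x}(v x − v y) = Σ_x Σ_{y ∼ x} (v x − v y)²`. [folklore] -/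
theorem two_mul_lapFormR {N : Fin (d + 1) → ℕ} (v : ↥(boxDom N) → ℝ) :
    2 * ∑ x, v x * ∑ y ∈ boxNbrs N x, (v x - v y) = ∑ x, ∑ y ∈ boxNbrs N x, (v x - v y) ^ 2 := by
  have hswap₁ : ∑ x, ∑ y ∈ boxNbrs N x, v y * v y = ∑ x, ∑ y ∈ boxNbrs N x, v x * v x :=
    (sum_boxNbrs_commR fun x y => v x * v x).symm
  have hswap₂ : ∑ x, ∑ y ∈ boxNbrs N x, v y * v x = ∑ x, ∑ y ∈ boxNbrs N x, v x * v y :=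
    (sum_boxNbrs_commR fun x y => v x * v y).symm
  have hL : ∑ x, v x * ∑ y ∈ boxNbrs N x, (v x - v y)
      = (∑ x, ∑ y ∈ boxNbrs N x, v x * v x) - ∑ x, ∑ y ∈ boxNbrs N x, v x * v y := by
    rw [← Finset.sum_sub_distrib]
    refine Finset.sum_congr rfl fun x _ => ?_
    rw [Finset.mul_sum, ← Finset.sum_sub_distrib]
    refine Finset.sum_congr rfl fun y _ => ?_
    ring
  have hR : ∑ x, ∑ y ∈ boxNbrs N x, (v x - v y) ^ 2
      = (∑ x, ∑ y ∈ boxNbrs N x, v x * v x) - (∑ x, ∑ y ∈ boxNbrs N x, v x * v y)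
        - (∑ x, ∑ y ∈ boxNbrs N x, v y * v x) + ∑ x, ∑ y ∈ boxNbrs N x, v y * v y := by
    rw [← Finset.sum_sub_distrib, ← Finset.sum_sub_distrib, ← Finset.sum_add_distrib]
    refine Finset.sum_congr rfl fun x _ => ?_
    rw [← Finset.sum_sub_distrib, ← Finset.sum_sub_distrib, ← Finset.sum_add_distrib]
    refine Finset.sum_congr rfl fun y _ => ?_
    ring
  rw [hL, hR, hswap₁, hswap₂]
  ring

/-- the real block form: `Σ_x v x·Σ_{blk y = blk x} v y = Σ_β (Σ_{blk x = β} v x)²` over the block labels met by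
the box. [folklore] -/
theorem avgFormR_eq (b : ℕ) {N : Fin (d + 1) → ℕ} (v : ↥(boxDom N) → ℝ) :
    ∑ x, v x * ∑ y ∈ boxBlk b N x, v y
      = ∑ β ∈ Finset.univ.image (fun x : ↥(boxDom N) => blk b x.1),
          (∑ y ∈ Finset.univ.filter (fun y : ↥(boxDom N) => blk b y.1 = β), v y) ^ 2 := by
  classical
  rw [← Finset.sum_fiberwise_of_maps_to (s := Finset.univ)
    (t := Finset.univ.image fun x : ↥(boxDom N) => blk b x.1) (g := fun x : ↥(boxDom N) => blk b x.1)
    (fun x hx => Finset.mem_image_of_mem _ hx)]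
  refine Finset.sum_congr rfl fun β _ => ?_
  rw [sq, Finset.sum_mul]
  refine Finset.sum_congr rfl fun x hx => ?_
  have hx' : blk b x.1 = β := (Finset.mem_filter.1 hx).2
  unfold boxBlk
  rw [hx']

/-- **THE REAL QUADRATIC FORM OF THE NEUMANN BOX OPERATOR**:
`v ⬝ (A v) = (c₁/2)·Σ_x Σ_{y ∼ x}(v x − v y)² + msq·Σ_x (v x)² + a·Σ_β (Σ_{blk x = β} v x)²`. [folklore] -/
theorem quadFormR_eq (c₁ msq a : ℝ) (b : ℕ) {N : Fin (d + 1) → ℕ} (v : ↥(boxDom N) → ℝ) :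
    v ⬝ᵥ (opBoxR c₁ msq a b N).mulVec v
      = c₁ / 2 * (∑ x, ∑ y ∈ boxNbrs N x, (v x - v y) ^ 2) + msq * (∑ x, v x ^ 2)
        + a * (∑ β ∈ Finset.univ.image (fun x : ↥(boxDom N) => blk b x.1),
            (∑ y ∈ Finset.univ.filter (fun y : ↥(boxDom N) => blk b y.1 = β), v y) ^ 2) := by
  have hpt : ∀ x, v x * (opBoxR c₁ msq a b N).mulVec v x
      = c₁ * (v x * ∑ y ∈ boxNbrs N x, (v x - v y)) + msq * (v x ^ 2) + a * (v x * ∑ y ∈ boxBlk b N x, v y) := by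
    intro x
    rw [opBoxR_mulVec]
    ring
  unfold dotProduct
  simp only [hpt, Finset.sum_add_distrib, ← Finset.mul_sum]
  rw [← two_mul_lapFormR, avgFormR_eq]
  ring

/-- the form of the real box operator is nonnegative (`a ≥ 0`, `m2 ≥ 0`). [folklore] -/
theorem boxOpR_form_nonneg (n : ℕ) {a m2 : ℝ} (ha : 0 ≤ a) (hm : 0 ≤ m2) (M : Fin (d + 1) → ℕ)
    (v : ↥(boxDom (fun i => n * M i)) → ℝ) : 0 ≤ v ⬝ᵥ (boxOpR n a m2 M).mulVec v := by
  rw [boxOpR, quadFormR_eq]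
  refine add_nonneg (add_nonneg (mul_nonneg (by positivity) ?_) (mul_nonneg hm ?_))
    (mul_nonneg (by positivity) ?_)
  · exact Finset.sum_nonneg fun _ _ => Finset.sum_nonneg fun _ _ => sq_nonneg _
  · exact Finset.sum_nonneg fun _ _ => sq_nonneg _
  · exact Finset.sum_nonneg fun _ _ => sq_nonneg _

/-- the Green form is nonnegative: `0 ≤ w ⬝ G w`, `G = (boxOpR)⁻¹`. [folklore] -/
theorem boxOpR_inv_form_nonneg {n : ℕ} (hn : 1 ≤ n) {a m2 : ℝ} (ha : 0 < a) (hm : 0 ≤ m2)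
    {M : Fin (d + 1) → ℕ} (hM : ∀ i, 1 ≤ M i) (w : ↥(boxDom (fun i => n * M i)) → ℝ) :
    0 ≤ w ⬝ᵥ ((boxOpR n a m2 M)⁻¹).mulVec w := by
  set u := ((boxOpR n a m2 M)⁻¹).mulVec w with hu
  have hw : (boxOpR n a m2 M).mulVec u = w := by
    rw [hu, Matrix.mulVec_mulVec, boxOpR_mul_inv hn ha hm hM, Matrix.one_mulVec]
  calc (0 : ℝ) ≤ u ⬝ᵥ (boxOpR n a m2 M).mulVec u := boxOpR_form_nonneg n ha.le hm M u
    _ = w ⬝ᵥ u := by rw [hw, dotProduct_comm]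

/-! ## §3 B4's `Δ^{(j)}(□)` at `A = 0` on the unit box `□^{(j)} = Π[0, M_μ) ∩ ℤ^{d+1}`: definition, variational form -/

/-- the block indicator `indB n M y x = [blk n x = y]` (unit site `y ∈ □^{(j)}`, fine site `x ∈ X = Π[0, n·M_μ)`):
the matrix of `n^{d+1}·Q_j` (block sum); its transpose is the matrix of `Q_j^*` (piecewise-constant extension).
[folklore] -/
def indB (n : ℕ) (M : Fin (d + 1) → ℕ) : Matrix ↥(boxDom M) ↥(boxDom (fun i => n * M i)) ℝ :=
  Matrix.of fun y x => if blk n x.1 = y.1 then 1 else 0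

/-- **B4 (1.14) = (2.34)'s `Δ^{(j)}(□)` at zero background field, lattice units, as a real matrix on the unit box**:
`Δ^{(j)}(□) = a_j I − a_j² Q_j G_j(□) Q_j^*` with `G_j(□) = (boxOpR n a_j m2 M)⁻¹` the Neumann box Green function of
B4 (2.44) (`B4Green242Bridge.boxOp`, cast by `boxOp_inv_eq_map`), `Q_j = n^{−(d+1)}·indB`, `Q_j^* = indBᵀ`:
`a·1 − (a²/n^{d+1})·indB·G·indBᵀ`. [cite: Balaban1983RegularityDecay, p. 573 (1.14), dictionary] [folklore] -/
def Keff (n : ℕ) (a m2 : ℝ) (M : Fin (d + 1) → ℕ) : Matrix ↥(boxDom M) ↥(boxDom M) ℝ :=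
  a • (1 : Matrix ↥(boxDom M) ↥(boxDom M) ℝ)
    - (a ^ 2 * ((n : ℝ) ^ (d + 1))⁻¹) • (indB n M * (boxOpR n a m2 M)⁻¹ * (indB n M)ᵀ)

/-- the block sum: `(indB g)(y) = Σ_{x ∈ X, blk x = y} g x`. [folklore] -/
theorem indB_mulVec (n : ℕ) (M : Fin (d + 1) → ℕ) (g : ↥(boxDom (fun i => n * M i)) → ℝ) (y : ↥(boxDom M)) :
    (indB n M).mulVec g y = ∑ x ∈ Finset.univ.filter (fun x : ↥(boxDom (fun i => n * M i)) => blk n x.1 = y.1), g x := by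
  rw [Finset.sum_filter]
  unfold Matrix.mulVec dotProduct
  refine Finset.sum_congr rfl fun x _ => ?_
  simp only [indB, Matrix.of_apply]
  split_ifs <;> simp

/-- the double block sum: `(indB·G·indBᵀ)(y,y′) = Σ_{blk x = y} Σ_{blk x′ = y′} G(x,x′)`. [folklore] -/
theorem indB_mul_mul_transpose_apply (n : ℕ) (M : Fin (d + 1) → ℕ)
    (G : Matrix ↥(boxDom (fun i => n * M i)) ↥(boxDom (fun i => n * M i)) ℝ) (y y' : ↥(boxDom M)) :
    (indB n M * G * (indB n M)ᵀ) y y'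
      = ∑ x ∈ Finset.univ.filter (fun x : ↥(boxDom (fun i => n * M i)) => blk n x.1 = y.1),
          ∑ x' ∈ Finset.univ.filter (fun x' : ↥(boxDom (fun i => n * M i)) => blk n x'.1 = y'.1), G x x' := by
  rw [Matrix.mul_apply]
  have hinner : ∀ x' : ↥(boxDom (fun i => n * M i)), (indB n M * G) y x'
      = ∑ x ∈ Finset.univ.filter (fun x : ↥(boxDom (fun i => n * M i)) => blk n x.1 = y.1), G x x' := by
    intro x'
    rw [Matrix.mul_apply, Finset.sum_filter]
    refine Finset.sum_congr rfl fun x _ => ?_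
    simp only [indB, Matrix.of_apply]
    split_ifs <;> simp
  simp_rw [hinner]
  rw [Finset.sum_comm, Finset.sum_filter]
  refine Finset.sum_congr rfl fun x' _ => ?_
  simp only [indB, Matrix.transpose_apply, Matrix.of_apply]
  split_ifs <;> simp

/-- `Δ^{(j)}(□)` is symmetric. [folklore] -/
theorem Keff_isSymm (n : ℕ) (a m2 : ℝ) (M : Fin (d + 1) → ℕ) : (Keff n a m2 M).IsSymm := by
  have hG := boxOpR_inv_isSymm n a m2 M
  unfold Matrix.IsSymm at hG ⊢
  simp only [Keff, Matrix.transpose_sub, Matrix.transpose_smul, Matrix.transpose_one, Matrix.transpose_mul,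
    Matrix.transpose_transpose, hG, Matrix.mul_assoc]

/-- the form of `Δ^{(j)}(□)`: `ψ ⬝ Δψ = a‖ψ‖² − (a²/n^{d+1})·(indBᵀψ) ⬝ G (indBᵀψ)`. [folklore] -/
theorem Keff_form_eq (n : ℕ) (a m2 : ℝ) (M : Fin (d + 1) → ℕ) (ψ : ↥(boxDom M) → ℝ) :
    ψ ⬝ᵥ (Keff n a m2 M).mulVec ψ
      = a * (ψ ⬝ᵥ ψ) - a ^ 2 * ((n : ℝ) ^ (d + 1))⁻¹ *
          ((indB n M)ᵀ.mulVec ψ ⬝ᵥ ((boxOpR n a m2 M)⁻¹).mulVec ((indB n M)ᵀ.mulVec ψ)) := by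
  rw [Keff, Matrix.sub_mulVec, Matrix.smul_mulVec, Matrix.one_mulVec, dotProduct_sub, dotProduct_smul,
    smul_eq_mul, Matrix.smul_mulVec, dotProduct_smul, smul_eq_mul, ← Matrix.mulVec_mulVec, ← Matrix.mulVec_mulVec,
    Matrix.dotProduct_mulVec ψ (indB n M), ← Matrix.mulVec_transpose]

/-- **UPPER BOUND** `ψ ⬝ Δ^{(j)}(□)ψ ≤ a_j‖ψ‖²` (the Green form is nonnegative). [folklore] -/
theorem Keff_form_le {n : ℕ} (hn : 1 ≤ n) {a m2 : ℝ} (ha : 0 < a) (hm : 0 ≤ m2) {M : Fin (d + 1) → ℕ}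
    (hM : ∀ i, 1 ≤ M i) (ψ : ↥(boxDom M) → ℝ) : ψ ⬝ᵥ (Keff n a m2 M).mulVec ψ ≤ a * (ψ ⬝ᵥ ψ) := by
  rw [Keff_form_eq]
  have h := boxOpR_inv_form_nonneg hn ha hm hM ((indB n M)ᵀ.mulVec ψ)
  have : 0 ≤ a ^ 2 * ((n : ℝ) ^ (d + 1))⁻¹
      * ((indB n M)ᵀ.mulVec ψ ⬝ᵥ ((boxOpR n a m2 M)⁻¹).mulVec ((indB n M)ᵀ.mulVec ψ)) :=
    mul_nonneg (by positivity) h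
  linarith

/-- the minimiser `g⋆ = a·G(indBᵀψ)` of the constrained fine energy. [folklore] -/
def gStar (n : ℕ) (a m2 : ℝ) (M : Fin (d + 1) → ℕ) (ψ : ↥(boxDom M) → ℝ) :
    ↥(boxDom (fun i => n * M i)) → ℝ :=
  a • ((boxOpR n a m2 M)⁻¹).mulVec ((indB n M)ᵀ.mulVec ψ)

/-- completing the square: `a‖ψ − N⁻¹·indB g‖² + N⁻¹(g ⬝ Tg − (a/N)‖indB g‖²) = a‖ψ‖² − (2a/N)(indBᵀψ) ⬝ g +
N⁻¹ g ⬝ Tg` (`N = n^{d+1}`). [folklore] -/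
theorem energy_expand (n : ℕ) (a m2 : ℝ) (M : Fin (d + 1) → ℕ) (ψ : ↥(boxDom M) → ℝ)
    (g : ↥(boxDom (fun i => n * M i)) → ℝ) :
    a * (∑ y, (ψ y - ((n : ℝ) ^ (d + 1))⁻¹ * (indB n M).mulVec g y) ^ 2)
      + ((n : ℝ) ^ (d + 1))⁻¹ * (g ⬝ᵥ (boxOpR n a m2 M).mulVec g
          - a * ((n : ℝ) ^ (d + 1))⁻¹ * ∑ y, (indB n M).mulVec g y ^ 2)
      = a * (ψ ⬝ᵥ ψ) - 2 * a * ((n : ℝ) ^ (d + 1))⁻¹ * ((indB n M)ᵀ.mulVec ψ ⬝ᵥ g)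
        + ((n : ℝ) ^ (d + 1))⁻¹ * (g ⬝ᵥ (boxOpR n a m2 M).mulVec g) := by
  have hcross : (indB n M)ᵀ.mulVec ψ ⬝ᵥ g = ∑ y, ψ y * (indB n M).mulVec g y := by
    rw [Matrix.mulVec_transpose, ← Matrix.dotProduct_mulVec]
    rfl
  have hsq : ∑ y, (ψ y - ((n : ℝ) ^ (d + 1))⁻¹ * (indB n M).mulVec g y) ^ 2
      = (ψ ⬝ᵥ ψ) - 2 * ((n : ℝ) ^ (d + 1))⁻¹ * (∑ y, ψ y * (indB n M).mulVec g y)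
        + (((n : ℝ) ^ (d + 1))⁻¹) ^ 2 * ∑ y, (indB n M).mulVec g y ^ 2 := by
    unfold dotProduct
    rw [Finset.mul_sum, Finset.mul_sum, ← Finset.sum_sub_distrib, ← Finset.sum_add_distrib]
    refine Finset.sum_congr rfl fun y _ => ?_
    ring
  rw [hsq, hcross]
  ring

/-- **THE VARIATIONAL VALUE**: `ψ ⬝ Δ^{(j)}(□)ψ = a‖ψ − Q g⋆‖² + N⁻¹·(g⋆ ⬝ T g⋆ − (a/N)‖indB g⋆‖²)` with
`Q = N⁻¹·indB`, `g⋆ = a G indBᵀψ` (uses only `T·G = 1`). [folklore] -/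
theorem Keff_form_eq_energy {n : ℕ} (hn : 1 ≤ n) {a m2 : ℝ} (ha : 0 < a) (hm : 0 ≤ m2) {M : Fin (d + 1) → ℕ}
    (hM : ∀ i, 1 ≤ M i) (ψ : ↥(boxDom M) → ℝ) :
    ψ ⬝ᵥ (Keff n a m2 M).mulVec ψ
      = a * (∑ y, (ψ y - ((n : ℝ) ^ (d + 1))⁻¹ * (indB n M).mulVec (gStar n a m2 M ψ) y) ^ 2)
        + ((n : ℝ) ^ (d + 1))⁻¹ * (gStar n a m2 M ψ ⬝ᵥ (boxOpR n a m2 M).mulVec (gStar n a m2 M ψ)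
            - a * ((n : ℝ) ^ (d + 1))⁻¹ * ∑ y, (indB n M).mulVec (gStar n a m2 M ψ) y ^ 2) := by
  rw [energy_expand, Keff_form_eq]
  set T := boxOpR n a m2 M
  set G := (boxOpR n a m2 M)⁻¹
  set φ := (indB n M)ᵀ.mulVec ψ
  have hT : ∀ v, T.mulVec (G.mulVec v) = v := fun v => by
    rw [Matrix.mulVec_mulVec, boxOpR_mul_inv hn ha hm hM, Matrix.one_mulVec]
  have hg : gStar n a m2 M ψ = a • G.mulVec φ := rfl
  rw [hg]
  have h1 : a • G.mulVec φ ⬝ᵥ T.mulVec (a • G.mulVec φ) = a * (a * (φ ⬝ᵥ G.mulVec φ)) := by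
    rw [Matrix.mulVec_smul, hT, smul_dotProduct, dotProduct_smul, smul_eq_mul, smul_eq_mul, dotProduct_comm]
  have h2 : φ ⬝ᵥ a • G.mulVec φ = a * (φ ⬝ᵥ G.mulVec φ) := by
    rw [dotProduct_smul, smul_eq_mul]
  rw [h1, h2]
  ring

/-! ## §4 Bond forms on boxes, block charts, and the averaging inequality -/

open B4Green244 (finePt coarse offset coarse_finePt finePt_coarse_offset)

/-- the unit vector `e_μ ∈ ℤ^{d+1}`. [folklore] -/
def uvec (μ : Fin (d + 1)) : Fin (d + 1) → ℤ := Pi.single μ 1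

/-- `e_μ(μ) = 1`. [folklore] -/
@[simp] theorem uvec_apply_same (μ : Fin (d + 1)) : uvec μ μ = 1 := by simp [uvec]

/-- `e_μ(ν) = 0` for `ν ≠ μ`. [folklore] -/
@[simp] theorem uvec_apply_ne {μ ν : Fin (d + 1)} (h : ν ≠ μ) : uvec μ ν = 0 := by simp [uvec, h]

/-- `μ ↦ e_μ` is injective. [folklore] -/
theorem uvec_injective : Function.Injective (uvec (d := d)) := by
  intro μ ν h
  by_contra hne
  have h1 := congrFun h μ
  rw [uvec_apply_same, uvec_apply_ne hne] at h1
  exact one_ne_zero h1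

/-- Cauchy–Schwarz for a double sum: `(Σ_i Σ_j f)² ≤ |s|·|t|·Σ_i Σ_j f²`. [folklore] -/
theorem sq_sum_sum_le {α β : Type*} (s : Finset α) (t : Finset β) (f : α → β → ℝ) :
    (∑ i ∈ s, ∑ j ∈ t, f i j) ^ 2 ≤ ((s.card : ℝ) * t.card) * ∑ i ∈ s, ∑ j ∈ t, f i j ^ 2 := by
  have h := sq_sum_le_card_mul_sum_sq (s := s ×ˢ t) (f := fun p => f p.1 p.2)
  rw [Finset.sum_product, Finset.sum_product, Finset.card_product] at h
  push_cast at h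
  exact h

/-- zero extension of a box function to the whole lattice. [folklore] -/
def extB (N : Fin (d + 1) → ℕ) (v : ↥(boxDom N) → ℝ) : (Fin (d + 1) → ℤ) → ℝ :=
  fun z => if hz : z ∈ boxDom N then v ⟨z, hz⟩ else 0

/-- the zero extension agrees with the function on the box. [folklore] -/
theorem extB_of_mem {N : Fin (d + 1) → ℕ} (v : ↥(boxDom N) → ℝ) {z : Fin (d + 1) → ℤ} (hz : z ∈ boxDom N) :
    extB N v z = v ⟨z, hz⟩ := by
  simp [extB, hz]

/-- the zero extension vanishes off the box. [folklore] -/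
theorem extB_of_not_mem {N : Fin (d + 1) → ℕ} (v : ↥(boxDom N) → ℝ) {z : Fin (d + 1) → ℤ} (hz : z ∉ boxDom N) :
    extB N v z = 0 := by
  simp [extB, hz]

/-- the zero extension at a box point. [folklore] -/
@[simp] theorem extB_coe {N : Fin (d + 1) → ℕ} (v : ↥(boxDom N) → ℝ) (x : ↥(boxDom N)) : extB N v x.1 = v x := by
  rw [extB_of_mem v x.2]

/-- the zero extension is additive. [folklore] -/
theorem extB_add {N : Fin (d + 1) → ℕ} (u v : ↥(boxDom N) → ℝ) : extB N (u + v) = extB N u + extB N v := by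
  funext z
  by_cases hz : z ∈ boxDom N
  · simp [extB_of_mem _ hz]
  · simp [extB_of_not_mem _ hz]

/-- the zero extension commutes with scalars. [folklore] -/
theorem extB_smul {N : Fin (d + 1) → ℕ} (c : ℝ) (v : ↥(boxDom N) → ℝ) : extB N (c • v) = c • extB N v := by
  funext z
  by_cases hz : z ∈ boxDom N
  · simp [extB_of_mem _ hz]
  · simp [extB_of_not_mem _ hz]

/-- **THE ORIENTED BOND FORM OF A BOX**: `Σ_μ Σ_{z, z+e_μ ∈ □} (h(z + e_μ) − h z)²` (each nearest-neighbour bond of the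
box once). [folklore] -/
def dirBox (N : Fin (d + 1) → ℕ) (h : (Fin (d + 1) → ℤ) → ℝ) : ℝ :=
  ∑ μ, ∑ z ∈ (boxDom N).filter (fun z => z + uvec μ ∈ boxDom N), (h (z + uvec μ) - h z) ^ 2

/-- the box Dirichlet form is nonnegative. [folklore] -/
theorem dirBox_nonneg (N : Fin (d + 1) → ℕ) (h : (Fin (d + 1) → ℤ) → ℝ) : 0 ≤ dirBox N h :=
  Finset.sum_nonneg fun _ _ => Finset.sum_nonneg fun _ _ => sq_nonneg _

/-- the box Dirichlet form only depends on the values on the box. [folklore] -/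
theorem dirBox_congr {N : Fin (d + 1) → ℕ} {h₁ h₂ : (Fin (d + 1) → ℤ) → ℝ} (H : ∀ z ∈ boxDom N, h₁ z = h₂ z) :
    dirBox N h₁ = dirBox N h₂ := by
  refine Finset.sum_congr rfl fun μ _ => Finset.sum_congr rfl fun z hz => ?_
  rw [Finset.mem_filter] at hz
  rw [H z hz.1, H _ hz.2]

/-- the box Dirichlet form is quadratic under scaling: `E(c•h) = c²E(h)`. [folklore] -/
theorem dirBox_smul (N : Fin (d + 1) → ℕ) (c : ℝ) (h : (Fin (d + 1) → ℤ) → ℝ) :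
    dirBox N (c • h) = c ^ 2 * dirBox N h := by
  unfold dirBox
  rw [Finset.mul_sum]
  refine Finset.sum_congr rfl fun μ _ => ?_
  rw [Finset.mul_sum]
  refine Finset.sum_congr rfl fun z _ => ?_
  simp only [Pi.smul_apply, smul_eq_mul]
  ring

/-- the parallelogram bound `E(h₁ + h₂) ≤ 2E(h₁) + 2E(h₂)`. [folklore] -/
theorem dirBox_add_le (N : Fin (d + 1) → ℕ) (h₁ h₂ : (Fin (d + 1) → ℤ) → ℝ) :
    dirBox N (h₁ + h₂) ≤ 2 * dirBox N h₁ + 2 * dirBox N h₂ := by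
  unfold dirBox
  rw [Finset.mul_sum, Finset.mul_sum, ← Finset.sum_add_distrib]
  refine Finset.sum_le_sum fun μ _ => ?_
  rw [Finset.mul_sum, Finset.mul_sum, ← Finset.sum_add_distrib]
  refine Finset.sum_le_sum fun z _ => ?_
  simp only [Pi.add_apply]
  nlinarith [sq_nonneg ((h₁ (z + uvec μ) - h₁ z) - (h₂ (z + uvec μ) - h₂ z))]

/-- the squared norm of a box function through its zero extension. [folklore] -/
theorem sum_boxDom_extB_sq {N : Fin (d + 1) → ℕ} (v : ↥(boxDom N) → ℝ) :
    ∑ z ∈ boxDom N, extB N v z ^ 2 = v ⬝ᵥ v := by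
  rw [← Finset.sum_coe_sort (boxDom N)]
  unfold dotProduct
  refine Finset.sum_congr rfl fun x _ => ?_
  rw [extB_coe, sq]

/-- `E_□(v) ≤ 4(d+1)‖v‖²`. [folklore] -/
theorem dirBox_extB_le_norm {N : Fin (d + 1) → ℕ} (v : ↥(boxDom N) → ℝ) :
    dirBox N (extB N v) ≤ 4 * (d + 1) * (v ⬝ᵥ v) := by
  classical
  have hμ : ∀ μ : Fin (d + 1),
      ∑ z ∈ (boxDom N).filter (fun z => z + uvec μ ∈ boxDom N), (extB N v (z + uvec μ) - extB N v z) ^ 2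
        ≤ 4 * (v ⬝ᵥ v) := by
    intro μ
    set F := (boxDom N).filter (fun z => z + uvec μ ∈ boxDom N) with hF
    have h1 : ∑ z ∈ F, extB N v z ^ 2 ≤ v ⬝ᵥ v := by
      rw [← sum_boxDom_extB_sq v]
      exact Finset.sum_le_sum_of_subset_of_nonneg (Finset.filter_subset _ _) fun _ _ _ => sq_nonneg _
    have h2 : ∑ z ∈ F, extB N v (z + uvec μ) ^ 2 ≤ v ⬝ᵥ v := by
      have hinj : Set.InjOn (fun z : Fin (d + 1) → ℤ => z + uvec μ) ↑F := fun _ _ _ _ h => add_right_cancel h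
      rw [← Finset.sum_image (f := fun z => extB N v z ^ 2) hinj, ← sum_boxDom_extB_sq v]
      refine Finset.sum_le_sum_of_subset_of_nonneg ?_ fun _ _ _ => sq_nonneg _
      intro z hz
      obtain ⟨z', hz', rfl⟩ := Finset.mem_image.1 hz
      exact (Finset.mem_filter.1 hz').2
    calc ∑ z ∈ F, (extB N v (z + uvec μ) - extB N v z) ^ 2
        ≤ ∑ z ∈ F, (2 * extB N v (z + uvec μ) ^ 2 + 2 * extB N v z ^ 2) :=
          Finset.sum_le_sum fun z _ => by nlinarith [sq_nonneg (extB N v (z + uvec μ) + extB N v z)]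
      _ = 2 * ∑ z ∈ F, extB N v (z + uvec μ) ^ 2 + 2 * ∑ z ∈ F, extB N v z ^ 2 := by
          rw [Finset.sum_add_distrib, Finset.mul_sum, Finset.mul_sum]
      _ ≤ 4 * (v ⬝ᵥ v) := by linarith
  calc dirBox N (extB N v) ≤ ∑ _μ : Fin (d + 1), 4 * (v ⬝ᵥ v) := Finset.sum_le_sum fun μ _ => hμ μ
    _ = 4 * (d + 1) * (v ⬝ᵥ v) := by
        rw [Finset.sum_const, Finset.card_univ, Fintype.card_fin, nsmul_eq_mul]
        push_cast
        ring

/-- **THE ORIENTED BOND FORM IS DOMINATED BY THE UNORIENTED ONE**: `E_□(v) ≤ Σ_x Σ_{x′ ∼ x} (v x − v x′)²` (the right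
side counts every bond twice). [folklore] -/
theorem dirBox_extB_le_bondSum {N : Fin (d + 1) → ℕ} (v : ↥(boxDom N) → ℝ) :
    dirBox N (extB N v) ≤ ∑ x, ∑ x' ∈ boxNbrs N x, (v x - v x') ^ 2 := by
  -- rewrite the bond form as a sum over sites of the box and directions
  have hL : dirBox N (extB N v)
      = ∑ x : ↥(boxDom N), ∑ μ, if x.1 + uvec μ ∈ boxDom N
          then (extB N v (x.1 + uvec μ) - extB N v x.1) ^ 2 else 0 := by
    unfold dirBox
    simp only [Finset.sum_filter]
    rw [Finset.sum_comm, ← Finset.sum_coe_sort (boxDom N)]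
  rw [hL]
  refine Finset.sum_le_sum fun x _ => ?_
  -- for a fixed site, the directions with `x + e_μ ∈ □` inject into the box neighbours of `x`
  set f : Fin (d + 1) → ↥(boxDom N) := fun μ => if h : x.1 + uvec μ ∈ boxDom N then ⟨x.1 + uvec μ, h⟩ else x
    with hf
  set P : Finset (Fin (d + 1)) := Finset.univ.filter (fun μ => x.1 + uvec μ ∈ boxDom N) with hP
  have hfP : ∀ μ ∈ P, (f μ).1 = x.1 + uvec μ := by
    intro μ hμ
    have h := (Finset.mem_filter.1 hμ).2
    simp only [hf, dif_pos h]
  have hinj : Set.InjOn f ↑P := by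
    intro μ hμ ν hν h
    have h' := congrArg Subtype.val h
    rw [hfP μ hμ, hfP ν hν] at h'
    exact uvec_injective (add_left_cancel h')
  have hsub : P.image f ⊆ boxNbrs N x := by
    intro x' hx'
    obtain ⟨μ, hμ, rfl⟩ := Finset.mem_image.1 hx'
    unfold boxNbrs
    simp only [Finset.mem_filter, Finset.mem_univ, true_and]
    rw [hfP μ hμ]
    exact mem_nbrs.2 ⟨μ, Or.inl rfl⟩
  calc ∑ μ, (if x.1 + uvec μ ∈ boxDom N then (extB N v (x.1 + uvec μ) - extB N v x.1) ^ 2 else 0)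
      = ∑ μ ∈ P, (v x - v (f μ)) ^ 2 := by
        rw [hP, Finset.sum_filter]
        refine Finset.sum_congr rfl fun μ _ => ?_
        split_ifs with h
        · rw [extB_of_mem v h, extB_coe]
          simp only [hf, dif_pos h]
          ring
        · rfl
    _ = ∑ x' ∈ P.image f, (v x - v x') ^ 2 := by rw [Finset.sum_image hinj]
    _ ≤ ∑ x' ∈ boxNbrs N x, (v x - v x') ^ 2 :=
        Finset.sum_le_sum_of_subset_of_nonneg hsub fun _ _ _ => sq_nonneg _

/-- **THE ORIENTED BONDS OF A BOX AS A FINITE TYPE**: pairs `(y, μ)` with `y, y + e_μ ∈ □`. [folklore] -/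
abbrev UBond (N : Fin (d + 1) → ℕ) : Type :=
  {p : ↥(boxDom N) × Fin (d + 1) // p.1.1 + uvec p.2 ∈ boxDom N}

/-- source `y` of the bond `(y, μ)`. [folklore] -/
def bsrc {N : Fin (d + 1) → ℕ} (k : UBond N) : ↥(boxDom N) := k.1.1

/-- target `y + e_μ` of the bond `(y, μ)`. [folklore] -/
def btgt {N : Fin (d + 1) → ℕ} (k : UBond N) : ↥(boxDom N) := ⟨k.1.1.1 + uvec k.1.2, k.2⟩

/-- the bond-type Dirichlet sum is the oriented bond form of the zero extension. [folklore] -/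
theorem sum_UBond_eq_dirBox {N : Fin (d + 1) → ℕ} (ω : ↥(boxDom N) → ℝ) :
    ∑ k : UBond N, (ω (btgt k) - ω (bsrc k)) ^ 2 = dirBox N (extB N ω) := by
  set Φ : ↥(boxDom N) × Fin (d + 1) → ℝ := fun p => (extB N ω (p.1.1 + uvec p.2) - extB N ω p.1.1) ^ 2
    with hΦ
  have h1 : ∀ k : UBond N, (ω (btgt k) - ω (bsrc k)) ^ 2 = Φ k.1 := by
    intro k
    simp only [hΦ, btgt, bsrc, extB_of_mem ω k.2, extB_coe]
  have h2 : ∑ k : UBond N, Φ k.1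
      = ∑ q ∈ Finset.univ.filter (fun q : ↥(boxDom N) × Fin (d + 1) => q.1.1 + uvec q.2 ∈ boxDom N), Φ q :=
    (Finset.sum_subtype (p := fun q : ↥(boxDom N) × Fin (d + 1) => q.1.1 + uvec q.2 ∈ boxDom N)
      (Finset.univ.filter (fun q : ↥(boxDom N) × Fin (d + 1) => q.1.1 + uvec q.2 ∈ boxDom N))
      (fun q => by rw [Finset.mem_filter]; exact ⟨fun h => h.2, fun h => ⟨Finset.mem_univ _, h⟩⟩) Φ).symm
  rw [Fintype.sum_congr _ _ h1, h2, Finset.sum_filter, Fintype.sum_prod_type]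
  simp only [hΦ]
  unfold dirBox
  simp only [Finset.sum_filter]
  rw [Finset.sum_comm (s := Finset.univ) (t := boxDom N), ← Finset.sum_coe_sort (boxDom N)]

/-! ### block charts: the fine points of the block over a unit site -/

/-- coordinates of a chart point: `(finePt n y j) i = n·y i + j i`. [folklore] -/
theorem finePt_apply (n : ℕ) (y : Fin (d + 1) → ℤ) (j : Fin (d + 1) → Fin n) (i : Fin (d + 1)) :
    finePt n y j i = (n : ℤ) * y i + ((j i : ℕ) : ℤ) := rfl

/-- the fine points of the block over a unit site of the box lie in the fine box. [folklore] -/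
theorem finePt_mem_boxDom (n : ℕ) {M : Fin (d + 1) → ℕ} {y : Fin (d + 1) → ℤ} (hy : y ∈ boxDom M)
    (j : Fin (d + 1) → Fin n) : finePt n y j ∈ boxDom (fun i => n * M i) := by
  rw [mem_boxDom] at hy ⊢
  intro i
  obtain ⟨h0, h1⟩ := hy i
  have hj0 : (0 : ℤ) ≤ ((j i : ℕ) : ℤ) := by positivity
  have hj1 : ((j i : ℕ) : ℤ) < n := by exact_mod_cast (j i).isLt
  have hn0 : (0 : ℤ) ≤ n := by positivity
  refine ⟨by rw [finePt_apply]; nlinarith, ?_⟩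
  rw [finePt_apply]
  push_cast
  have h2 : y i + 1 ≤ (M i : ℤ) := h1
  nlinarith

/-- block label of a chart point. [folklore] -/
theorem blk_finePt {n : ℕ} (hn : 1 ≤ n) (y : Fin (d + 1) → ℤ) (j : Fin (d + 1) → Fin n) :
    blk n (finePt n y j) = y := by
  haveI : NeZero n := ⟨by omega⟩
  exact coarse_finePt n y j

/-- the chart is injective. [folklore] -/
theorem finePt_injective (n : ℕ) (y : Fin (d + 1) → ℤ) : Function.Injective (finePt n y) := by
  intro j j' h
  funext i
  have hi := congrFun h i
  rw [finePt_apply, finePt_apply] at hi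
  exact Fin.ext (by exact_mod_cast (add_left_cancel hi))

/-- every point with block label `y` is a chart point. [folklore] -/
theorem finePt_offset_of_blk {n : ℕ} (hn : 1 ≤ n) {x y : Fin (d + 1) → ℤ} (h : blk n x = y) :
    ∃ j : Fin (d + 1) → Fin n, finePt n y j = x := by
  haveI : NeZero n := ⟨by omega⟩
  refine ⟨offset n x, ?_⟩
  rw [← h]
  exact finePt_coarse_offset n x

/-- **THE BLOCK OVER A UNIT SITE IS THE IMAGE OF ITS CHART**. [folklore] -/
theorem filter_blk_eq_image {n : ℕ} (hn : 1 ≤ n) (M : Fin (d + 1) → ℕ) (y : ↥(boxDom M)) :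
    Finset.univ.filter (fun x : ↥(boxDom (fun i => n * M i)) => blk n x.1 = y.1)
      = Finset.univ.image (fun j : Fin (d + 1) → Fin n =>
          (⟨finePt n y.1 j, finePt_mem_boxDom n y.2 j⟩ : ↥(boxDom (fun i => n * M i)))) := by
  ext x
  simp only [Finset.mem_filter, Finset.mem_univ, true_and, Finset.mem_image]
  constructor
  · intro h
    obtain ⟨j, hj⟩ := finePt_offset_of_blk hn h
    exact ⟨j, Subtype.ext hj⟩
  · rintro ⟨j, rfl⟩
    exact blk_finePt hn y.1 j

/-- the block has `n^{d+1}` fine points. [folklore] -/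
theorem card_filter_blk {n : ℕ} (hn : 1 ≤ n) (M : Fin (d + 1) → ℕ) (y : ↥(boxDom M)) :
    (Finset.univ.filter (fun x : ↥(boxDom (fun i => n * M i)) => blk n x.1 = y.1)).card = n ^ (d + 1) := by
  rw [filter_blk_eq_image hn M y, Finset.card_image_of_injective, Finset.card_univ, Fintype.card_fun,
    Fintype.card_fin, Fintype.card_fin]
  intro j j' h
  exact finePt_injective n y.1 (congrArg Subtype.val h)

/-- **THE BLOCK SUM THROUGH THE CHART**: `(indB g)(y) = Σ_j g(n·y + j)`. [folklore] -/
theorem indB_mulVec_eq_chartSum {n : ℕ} (hn : 1 ≤ n) (M : Fin (d + 1) → ℕ)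
    (g : ↥(boxDom (fun i => n * M i)) → ℝ) (y : ↥(boxDom M)) :
    (indB n M).mulVec g y = ∑ j : Fin (d + 1) → Fin n, extB (fun i => n * M i) g (finePt n y.1 j) := by
  rw [indB_mulVec, filter_blk_eq_image hn M y, Finset.sum_image]
  · refine Finset.sum_congr rfl fun j _ => ?_
    rw [extB_of_mem g (finePt_mem_boxDom n y.2 j)]
  · intro j _ j' _ h
    exact finePt_injective n y.1 (congrArg Subtype.val h)

/-- the block-sum square over the labels met by the fine box is the block-sum square over the unit box. [folklore] -/
theorem blockSq_eq {n : ℕ} (hn : 1 ≤ n) (M : Fin (d + 1) → ℕ) (g : ↥(boxDom (fun i => n * M i)) → ℝ) :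
    ∑ β ∈ Finset.univ.image (fun x : ↥(boxDom (fun i => n * M i)) => blk n x.1),
        (∑ x ∈ Finset.univ.filter (fun x : ↥(boxDom (fun i => n * M i)) => blk n x.1 = β), g x) ^ 2
      = ∑ y : ↥(boxDom M), (indB n M).mulVec g y ^ 2 := by
  have hR : ∑ y : ↥(boxDom M), (indB n M).mulVec g y ^ 2
      = ∑ β ∈ boxDom M,
          (∑ x ∈ Finset.univ.filter (fun x : ↥(boxDom (fun i => n * M i)) => blk n x.1 = β), g x) ^ 2 := by
    rw [← Finset.sum_coe_sort (boxDom M)]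
    refine Finset.sum_congr rfl fun y _ => ?_
    rw [indB_mulVec]
  rw [hR]
  symm
  refine (Finset.sum_subset ?_ ?_).symm
  · intro β hβ
    obtain ⟨x, _, rfl⟩ := Finset.mem_image.1 hβ
    exact blk_mem_boxDom hn x.2
  · intro β _ hβ
    have hempty : Finset.univ.filter (fun x : ↥(boxDom (fun i => n * M i)) => blk n x.1 = β) = ∅ := by
      rw [Finset.filter_eq_empty_iff]
      intro x _ hx
      exact hβ (Finset.mem_image.2 ⟨x, Finset.mem_univ _, hx⟩)
    rw [hempty, Finset.sum_empty]
    ring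

/-- **THE FINE KINETIC FORM**: `g ⬝ Tg − (a/N)·Σ_y (indB g)_y² = (n²/2)·ΣΣ(g x − g x′)² + m2‖g‖² ≥ (n²/2)·ΣΣ(g x − g x′)²`.
[folklore] -/
theorem fineEnergy_eq {n : ℕ} (hn : 1 ≤ n) (a m2 : ℝ) (M : Fin (d + 1) → ℕ)
    (g : ↥(boxDom (fun i => n * M i)) → ℝ) :
    g ⬝ᵥ (boxOpR n a m2 M).mulVec g - a * ((n : ℝ) ^ (d + 1))⁻¹ * ∑ y, (indB n M).mulVec g y ^ 2
      = (n : ℝ) ^ 2 / 2 * (∑ x, ∑ x' ∈ boxNbrs (fun i => n * M i) x, (g x - g x') ^ 2) + m2 * ∑ x, g x ^ 2 := by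
  rw [boxOpR, quadFormR_eq, blockSq_eq hn M g]
  ring

/-- the fine energy without the averaging term dominates `(n²/2)·` the fine bond form (the mass term is nonnegative). [folklore] -/
theorem fineEnergy_ge {n : ℕ} (hn : 1 ≤ n) (a : ℝ) {m2 : ℝ} (hm : 0 ≤ m2) (M : Fin (d + 1) → ℕ)
    (g : ↥(boxDom (fun i => n * M i)) → ℝ) :
    (n : ℝ) ^ 2 / 2 * (∑ x, ∑ x' ∈ boxNbrs (fun i => n * M i) x, (g x - g x') ^ 2)
      ≤ g ⬝ᵥ (boxOpR n a m2 M).mulVec g - a * ((n : ℝ) ^ (d + 1))⁻¹ * ∑ y, (indB n M).mulVec g y ^ 2 := by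
  rw [fineEnergy_eq hn a m2 M g]
  have : 0 ≤ m2 * ∑ x, g x ^ 2 := mul_nonneg hm (Finset.sum_nonneg fun _ _ => sq_nonneg _)
  linarith

/-! ### the averaging inequality: the bond form of block sums is controlled by the fine bond form -/

/-- chart shift: `finePt n (y + e_μ) j = finePt n y j + n·e_μ`. [folklore] -/
theorem finePt_add_uvec (n : ℕ) (y : Fin (d + 1) → ℤ) (μ : Fin (d + 1)) (j : Fin (d + 1) → Fin n) :
    finePt n (y + uvec μ) j = finePt n y j + (n : ℤ) • uvec μ := by
  funext i
  simp only [finePt_apply, Pi.add_apply, Pi.smul_apply, smul_eq_mul]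
  by_cases hi : i = μ
  · subst hi
    rw [uvec_apply_same]
    ring
  · rw [uvec_apply_ne hi]
    ring

/-- telescoping along `n` unit steps in direction `μ`. [folklore] -/
theorem telescope_uvec (h : (Fin (d + 1) → ℤ) → ℝ) (x : Fin (d + 1) → ℤ) (μ : Fin (d + 1)) (n : ℕ) :
    h (x + (n : ℤ) • uvec μ) - h x
      = ∑ t ∈ Finset.range n, (h (x + (t : ℤ) • uvec μ + uvec μ) - h (x + (t : ℤ) • uvec μ)) := by
  have htel := Finset.sum_range_sub (fun t : ℕ => h (x + (t : ℤ) • uvec μ)) n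
  simp only [Nat.cast_zero, zero_smul, add_zero] at htel
  rw [← htel]
  refine Finset.sum_congr rfl fun t _ => ?_
  have : x + ((t + 1 : ℕ) : ℤ) • uvec μ = x + (t : ℤ) • uvec μ + uvec μ := by
    push_cast
    rw [add_smul, one_smul, add_assoc]
  rw [this]

/-- `0 ≤ r < 2n ⇒ r / n ∈ {0, 1}`. [folklore] -/
theorem ediv_eq_zero_or_one {r n : ℤ} (hn : 0 < n) (h0 : 0 ≤ r) (h2 : r < 2 * n) : r / n = 0 ∨ r / n = 1 := by
  by_cases hr : r < n
  · exact Or.inl (Int.ediv_eq_zero_of_lt h0 hr)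
  · right
    have h1 : 1 ≤ r / n := by rw [Int.le_ediv_iff_mul_le hn]; linarith
    have h3 : r / n < 2 := by rw [Int.ediv_lt_iff_lt_mul hn]; linarith
    omega

/-- "the fine point lies in the block of `y` or of `y + e_μ`". [folklore] -/
def NearBlk (n : ℕ) (μ : Fin (d + 1)) (y z : Fin (d + 1) → ℤ) : Prop := blk n z = y ∨ blk n z = y + uvec μ

/-- membership in "the block of `y` or of `y + e_μ`" is decidable. [folklore] -/
instance (n : ℕ) (μ : Fin (d + 1)) (y : Fin (d + 1) → ℤ) : DecidablePred (NearBlk n μ y) := fun z => by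
  unfold NearBlk; infer_instance

/-- the `μ`-bonds `⟨z, z + e_μ⟩` of a box, as the set of their sources. [folklore] -/
def bondSet (N : Fin (d + 1) → ℕ) (μ : Fin (d + 1)) : Finset (Fin (d + 1) → ℤ) :=
  (boxDom N).filter (fun z => z + uvec μ ∈ boxDom N)

/-- the box Dirichlet form as a sum over the bond sources, by direction. [folklore] -/
theorem dirBox_eq_sum_bondSet (N : Fin (d + 1) → ℕ) (h : (Fin (d + 1) → ℤ) → ℝ) :
    dirBox N h = ∑ μ, ∑ z ∈ bondSet N μ, (h (z + uvec μ) - h z) ^ 2 := rfl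

/-- **THE PATH POINTS**: for a unit bond `⟨y, y + e_μ⟩` of the unit box, an offset `j` and `t < n`, the fine point
`z = n·y + j + t·e_μ` and `z + e_μ` lie in the fine box, and `z` lies in the block of `y` or of `y + e_μ`. [folklore] -/
theorem pathPt_facts {n : ℕ} (hn : 1 ≤ n) {M : Fin (d + 1) → ℕ} {y : Fin (d + 1) → ℤ} {μ : Fin (d + 1)}
    (hy : y ∈ boxDom M) (hy' : y + uvec μ ∈ boxDom M) (j : Fin (d + 1) → Fin n) {t : ℕ} (ht : t < n) :
    finePt n y j + (t : ℤ) • uvec μ ∈ bondSet (fun i => n * M i) μ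
      ∧ NearBlk n μ y (finePt n y j + (t : ℤ) • uvec μ) := by
  have hn0 : (0 : ℤ) < n := by exact_mod_cast hn
  have ht' : (t : ℤ) < n := by exact_mod_cast ht
  have ht0 : (0 : ℤ) ≤ t := by positivity
  rw [mem_boxDom] at hy hy'
  have hcoord : ∀ i, (finePt n y j + (t : ℤ) • uvec μ) i
      = (n : ℤ) * y i + (((j i : ℕ) : ℤ) + (if i = μ then (t : ℤ) else 0)) := by
    intro i
    simp only [Pi.add_apply, finePt_apply, Pi.smul_apply, smul_eq_mul]
    by_cases hi : i = μ
    · subst hi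
      rw [uvec_apply_same, if_pos rfl]
      ring
    · rw [uvec_apply_ne hi, if_neg hi]
      ring
  have hj : ∀ i, (0 : ℤ) ≤ ((j i : ℕ) : ℤ) ∧ ((j i : ℕ) : ℤ) < n := fun i =>
    ⟨by positivity, by exact_mod_cast (j i).isLt⟩
  have hμ' : y μ + 1 < (M μ : ℤ) := by
    have := (hy' μ).2
    simpa [Pi.add_apply] using this
  -- the offset in each coordinate is in `[0, 2n)` (and in `[0, n)` off the direction `μ`)
  have hoff : ∀ i, (0 : ℤ) ≤ ((j i : ℕ) : ℤ) + (if i = μ then (t : ℤ) else 0)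
      ∧ ((j i : ℕ) : ℤ) + (if i = μ then (t : ℤ) else 0) + 1 < (if i = μ then 2 * (n : ℤ) else (n : ℤ) + 1) := by
    intro i
    obtain ⟨hj0, hj1⟩ := hj i
    split_ifs with hi
    · constructor <;> linarith
    · constructor <;> linarith
  have hmem : ∀ s : ℤ, 0 ≤ s → s ≤ 1 → finePt n y j + (t : ℤ) • uvec μ + s • uvec μ ∈ boxDom (fun i => n * M i) := by
    intro s hs0 hs1
    rw [mem_boxDom]
    intro i
    have hci : (finePt n y j + (t : ℤ) • uvec μ + s • uvec μ) i
        = (n : ℤ) * y i + (((j i : ℕ) : ℤ) + (if i = μ then (t : ℤ) else 0)) + (if i = μ then s else 0) := by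
      rw [Pi.add_apply, hcoord i, Pi.smul_apply, smul_eq_mul]
      by_cases hi : i = μ
      · subst hi; rw [uvec_apply_same, if_pos rfl, if_pos rfl, mul_one]
      · rw [uvec_apply_ne hi, if_neg hi, if_neg hi, mul_zero]
    rw [hci]
    obtain ⟨h0, h1⟩ := hy i
    obtain ⟨ho0, ho1⟩ := hoff i
    obtain ⟨hji0, hji1⟩ := hj i
    push_cast
    by_cases hi : i = μ
    · subst hi
      rw [if_pos rfl] at ho1 ⊢
      rw [if_pos rfl] at ho0
      rw [if_pos rfl]
      have h2 : y i + 2 ≤ (M i : ℤ) := by linarith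
      have h3 := mul_le_mul_of_nonneg_left h2 hn0.le
      constructor
      · nlinarith
      · linarith
    · rw [if_neg hi] at ho1 ho0 ⊢
      rw [if_neg hi]
      have h2 : y i + 1 ≤ (M i : ℤ) := h1
      have h3 := mul_le_mul_of_nonneg_left h2 hn0.le
      constructor
      · nlinarith
      · linarith
  refine ⟨?_, ?_⟩
  · unfold bondSet
    rw [Finset.mem_filter]
    have h0 := hmem 0 le_rfl zero_le_one
    have h1 := hmem 1 zero_le_one le_rfl
    rw [zero_smul, add_zero] at h0
    rw [one_smul] at h1
    exact ⟨h0, h1⟩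
  · -- block label
    have hq := ediv_eq_zero_or_one hn0 (r := ((j μ : ℕ) : ℤ) + (t : ℤ)) (by have := (hj μ).1; linarith)
      (by have := (hj μ).2; linarith)
    have hblk : ∀ i, blk n (finePt n y j + (t : ℤ) • uvec μ) i
        = y i + (((j i : ℕ) : ℤ) + (if i = μ then (t : ℤ) else 0)) / n := by
      intro i
      simp only [blk]
      rw [hcoord i, add_comm ((n : ℤ) * y i) _, Int.add_mul_ediv_left _ _ hn0.ne', add_comm]
    have hoffdiv : ∀ i, i ≠ μ → (((j i : ℕ) : ℤ) + (if i = μ then (t : ℤ) else 0)) / n = 0 := by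
      intro i hi
      rw [if_neg hi, add_zero]
      exact Int.ediv_eq_zero_of_lt (hj i).1 (hj i).2
    unfold NearBlk
    rcases hq with hq | hq
    · left
      funext i
      rw [hblk i]
      by_cases hi : i = μ
      · subst hi; rw [if_pos rfl, hq, add_zero]
      · rw [hoffdiv i hi, add_zero]
    · right
      funext i
      rw [hblk i, Pi.add_apply]
      by_cases hi : i = μ
      · subst hi; rw [if_pos rfl, hq, uvec_apply_same]
      · rw [hoffdiv i hi, uvec_apply_ne hi]

/-- at most two unit sites `y` have a given fine point in the block of `y` or of `y + e_μ`. [folklore] -/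
theorem card_filter_nearBlk_le (n : ℕ) (μ : Fin (d + 1)) (S : Finset (Fin (d + 1) → ℤ)) (z : Fin (d + 1) → ℤ) :
    (S.filter (fun y => NearBlk n μ y z)).card ≤ 2 := by
  classical
  calc (S.filter (fun y => NearBlk n μ y z)).card ≤ ({blk n z, blk n z - uvec μ} : Finset _).card := by
        refine Finset.card_le_card fun y hy => ?_
        have hq : NearBlk n μ y z := (Finset.mem_filter.1 hy).2
        unfold NearBlk at hq
        rw [Finset.mem_insert, Finset.mem_singleton]
        rcases hq with hq | hq
        · exact Or.inl hq.symm
        · right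
          rw [hq, add_sub_cancel_right]
    _ ≤ 2 := Finset.card_le_two

/-- **THE AVERAGING INEQUALITY** (Neumann box): the unit-box bond form of the block sums is at most `2·n^{d+3}`
times the fine-box bond form (telescoping along the `n` unit steps joining the two blocks, Cauchy–Schwarz, and each
fine bond serves at most two unit bonds). [folklore] -/
theorem dirBox_blockSum_le {n : ℕ} (hn : 1 ≤ n) (M : Fin (d + 1) → ℕ) (h : (Fin (d + 1) → ℤ) → ℝ) :
    dirBox M (fun y => ∑ j : Fin (d + 1) → Fin n, h (finePt n y j))
      ≤ 2 * (n : ℝ) ^ (d + 3) * dirBox (fun i => n * M i) h := by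
  have hn0 : (0 : ℝ) < n := by exact_mod_cast hn
  -- per unit bond
  have hbond : ∀ μ, ∀ y ∈ bondSet M μ,
      ((∑ j : Fin (d + 1) → Fin n, h (finePt n (y + uvec μ) j)) - ∑ j : Fin (d + 1) → Fin n, h (finePt n y j)) ^ 2
        ≤ (n : ℝ) ^ (d + 3) *
          ∑ z ∈ (bondSet (fun i => n * M i) μ).filter (fun z => NearBlk n μ y z), (h (z + uvec μ) - h z) ^ 2 := by
    intro μ y hy
    have hy2 := hy
    unfold bondSet at hy2
    obtain ⟨hyM, hy'⟩ := Finset.mem_filter.1 hy2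
    set S := ∑ z ∈ (bondSet (fun i => n * M i) μ).filter (fun z => NearBlk n μ y z), (h (z + uvec μ) - h z) ^ 2
      with hS
    have hS0 : 0 ≤ S := Finset.sum_nonneg fun _ _ => sq_nonneg _
    -- telescoping
    have hdiff : (∑ j : Fin (d + 1) → Fin n, h (finePt n (y + uvec μ) j)) - ∑ j : Fin (d + 1) → Fin n, h (finePt n y j)
        = ∑ j : Fin (d + 1) → Fin n, ∑ t ∈ Finset.range n,
            (h (finePt n y j + (t : ℤ) • uvec μ + uvec μ) - h (finePt n y j + (t : ℤ) • uvec μ)) := by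
      rw [← Finset.sum_sub_distrib]
      refine Finset.sum_congr rfl fun j _ => ?_
      rw [finePt_add_uvec, telescope_uvec]
    -- Cauchy–Schwarz
    have hCS := sq_sum_sum_le (Finset.univ : Finset (Fin (d + 1) → Fin n)) (Finset.range n)
      (fun j t => h (finePt n y j + (t : ℤ) • uvec μ + uvec μ) - h (finePt n y j + (t : ℤ) • uvec μ))
    rw [Finset.card_univ, Fintype.card_fun, Fintype.card_fin, Fintype.card_fin, Finset.card_range] at hCS
    push_cast at hCS
    -- each inner sum is a sum over distinct fine bonds near `y`
    have hinner : ∀ t ∈ Finset.range n,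
        ∑ j : Fin (d + 1) → Fin n,
            (h (finePt n y j + (t : ℤ) • uvec μ + uvec μ) - h (finePt n y j + (t : ℤ) • uvec μ)) ^ 2 ≤ S := by
      intro t ht
      have ht' : t < n := Finset.mem_range.1 ht
      have hinj : Set.InjOn (fun j : Fin (d + 1) → Fin n => finePt n y j + (t : ℤ) • uvec μ)
          ↑(Finset.univ : Finset (Fin (d + 1) → Fin n)) := by
        intro j _ j' _ hjj
        exact finePt_injective n y (add_right_cancel hjj)
      have hsub : Finset.univ.image (fun j : Fin (d + 1) → Fin n => finePt n y j + (t : ℤ) • uvec μ)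
          ⊆ (bondSet (fun i => n * M i) μ).filter (fun z => NearBlk n μ y z) := by
        intro z hz
        obtain ⟨j, _, rfl⟩ := Finset.mem_image.1 hz
        obtain ⟨h1, h2⟩ := pathPt_facts hn hyM hy' j ht'
        exact Finset.mem_filter.2 ⟨h1, h2⟩
      calc ∑ j : Fin (d + 1) → Fin n,
            (h (finePt n y j + (t : ℤ) • uvec μ + uvec μ) - h (finePt n y j + (t : ℤ) • uvec μ)) ^ 2
          = ∑ z ∈ Finset.univ.image (fun j : Fin (d + 1) → Fin n => finePt n y j + (t : ℤ) • uvec μ),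
              (h (z + uvec μ) - h z) ^ 2 := by
            rw [Finset.sum_image hinj]
        _ ≤ S := Finset.sum_le_sum_of_subset_of_nonneg hsub fun _ _ _ => sq_nonneg _
    have hsumt : ∑ j : Fin (d + 1) → Fin n, ∑ t ∈ Finset.range n,
        (h (finePt n y j + (t : ℤ) • uvec μ + uvec μ) - h (finePt n y j + (t : ℤ) • uvec μ)) ^ 2 ≤ n * S := by
      rw [Finset.sum_comm]
      calc ∑ t ∈ Finset.range n, ∑ j : Fin (d + 1) → Fin n,
            (h (finePt n y j + (t : ℤ) • uvec μ + uvec μ) - h (finePt n y j + (t : ℤ) • uvec μ)) ^ 2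
          ≤ ∑ _t ∈ Finset.range n, S := Finset.sum_le_sum hinner
        _ = n * S := by rw [Finset.sum_const, Finset.card_range, nsmul_eq_mul]
    rw [hdiff]
    calc (∑ j : Fin (d + 1) → Fin n, ∑ t ∈ Finset.range n,
          (h (finePt n y j + (t : ℤ) • uvec μ + uvec μ) - h (finePt n y j + (t : ℤ) • uvec μ))) ^ 2
        ≤ (n : ℝ) ^ (d + 1) * n * ∑ j : Fin (d + 1) → Fin n, ∑ t ∈ Finset.range n,
            (h (finePt n y j + (t : ℤ) • uvec μ + uvec μ) - h (finePt n y j + (t : ℤ) • uvec μ)) ^ 2 := hCS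
      _ ≤ (n : ℝ) ^ (d + 1) * n * (n * S) := mul_le_mul_of_nonneg_left hsumt (by positivity)
      _ = (n : ℝ) ^ (d + 3) * S := by ring
  -- assemble: sum over unit bonds, exchange, count overlaps
  rw [dirBox_eq_sum_bondSet, dirBox_eq_sum_bondSet, Finset.mul_sum]
  refine Finset.sum_le_sum fun μ _ => ?_
  calc ∑ y ∈ bondSet M μ,
        ((∑ j : Fin (d + 1) → Fin n, h (finePt n (y + uvec μ) j)) - ∑ j : Fin (d + 1) → Fin n, h (finePt n y j)) ^ 2
      ≤ ∑ y ∈ bondSet M μ, (n : ℝ) ^ (d + 3) *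
          ∑ z ∈ (bondSet (fun i => n * M i) μ).filter (fun z => NearBlk n μ y z), (h (z + uvec μ) - h z) ^ 2 :=
        Finset.sum_le_sum (hbond μ)
    _ = (n : ℝ) ^ (d + 3) * ∑ z ∈ bondSet (fun i => n * M i) μ,
          (((bondSet M μ).filter (fun y => NearBlk n μ y z)).card : ℝ) * (h (z + uvec μ) - h z) ^ 2 := by
        rw [← Finset.mul_sum]
        congr 1
        simp only [Finset.sum_filter]
        rw [Finset.sum_comm]
        refine Finset.sum_congr rfl fun z _ => ?_
        rw [← Finset.sum_filter, Finset.sum_const, nsmul_eq_mul]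
    _ ≤ (n : ℝ) ^ (d + 3) * ∑ z ∈ bondSet (fun i => n * M i) μ, 2 * (h (z + uvec μ) - h z) ^ 2 := by
        refine mul_le_mul_of_nonneg_left (Finset.sum_le_sum fun z _ => ?_) (by positivity)
        refine mul_le_mul_of_nonneg_right ?_ (sq_nonneg _)
        exact_mod_cast card_filter_nearBlk_le n μ (bondSet M μ) z
    _ = 2 * (n : ℝ) ^ (d + 3) * ∑ z ∈ bondSet (fun i => n * M i) μ, (h (z + uvec μ) - h z) ^ 2 := by
        rw [← Finset.mul_sum]
        ring

/-- **THE BLOCK-AVERAGE BOND FORM IS CONTROLLED BY THE FINE BOND FORM**: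
`E_□(Q g) ≤ 2n²/N · Σ_x Σ_{x′ ∼ x}(g x − g x′)²` (`Q = N⁻¹·indB`, `N = n^{d+1}`). [folklore] -/
theorem dirBox_blockAvg_le {n : ℕ} (hn : 1 ≤ n) (M : Fin (d + 1) → ℕ) (g : ↥(boxDom (fun i => n * M i)) → ℝ) :
    dirBox M (extB M ((((n : ℝ) ^ (d + 1))⁻¹) • (indB n M).mulVec g))
      ≤ 2 * (n : ℝ) ^ 2 * ((n : ℝ) ^ (d + 1))⁻¹ * ∑ x, ∑ x' ∈ boxNbrs (fun i => n * M i) x, (g x - g x') ^ 2 := by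
  have hn0 : (0 : ℝ) < n := by exact_mod_cast hn
  rw [extB_smul, dirBox_smul]
  have hcongr : dirBox M (extB M ((indB n M).mulVec g))
      = dirBox M (fun y => ∑ j : Fin (d + 1) → Fin n, extB (fun i => n * M i) g (finePt n y j)) := by
    refine dirBox_congr fun y hy => ?_
    rw [extB_of_mem _ hy, indB_mulVec_eq_chartSum hn M g ⟨y, hy⟩]
  rw [hcongr]
  have h1 := dirBox_blockSum_le hn M (extB (fun i => n * M i) g)
  have h2 := dirBox_extB_le_bondSum (N := fun i => n * M i) g
  have h12 : dirBox M (fun y => ∑ j : Fin (d + 1) → Fin n, extB (fun i => n * M i) g (finePt n y j))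
      ≤ 2 * (n : ℝ) ^ (d + 3) * ∑ x, ∑ x' ∈ boxNbrs (fun i => n * M i) x, (g x - g x') ^ 2 :=
    h1.trans (mul_le_mul_of_nonneg_left h2 (by positivity))
  have hN : (n : ℝ) ^ (d + 1) ≠ 0 := by positivity
  calc (((n : ℝ) ^ (d + 1))⁻¹) ^ 2
        * dirBox M (fun y => ∑ j : Fin (d + 1) → Fin n, extB (fun i => n * M i) g (finePt n y j))
      ≤ (((n : ℝ) ^ (d + 1))⁻¹) ^ 2
        * (2 * (n : ℝ) ^ (d + 3) * ∑ x, ∑ x' ∈ boxNbrs (fun i => n * M i) x, (g x - g x') ^ 2) :=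
        mul_le_mul_of_nonneg_left h12 (by positivity)
    _ = 2 * (n : ℝ) ^ 2 * ((n : ℝ) ^ (d + 1))⁻¹ * ∑ x, ∑ x' ∈ boxNbrs (fun i => n * M i) x, (g x - g x') ^ 2 := by
        have h3 : (n : ℝ) ^ (d + 3) = (n : ℝ) ^ (d + 1) * (n : ℝ) ^ 2 := by ring
        rw [h3]
        field_simp

/-- **COERCIVITY OF `Δ^{(j)}(□)` BY THE UNIT BOND FORM** (Bałaban's basic lower bound, Neumann box, `A = 0`):
`ψ ⬝ Δ^{(j)}(□)ψ ≥ min(a/(8(d+1)), 1/8) · E_□(ψ)`, uniformly in `n = L^j` and the box. [folklore] -/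
theorem Keff_form_ge {n : ℕ} (hn : 1 ≤ n) {a m2 : ℝ} (ha : 0 < a) (hm : 0 ≤ m2) {M : Fin (d + 1) → ℕ}
    (hM : ∀ i, 1 ≤ M i) (ψ : ↥(boxDom M) → ℝ) :
    min (a / (8 * (d + 1))) (1 / 8) * dirBox M (extB M ψ) ≤ ψ ⬝ᵥ (Keff n a m2 M).mulVec ψ := by
  have hn0 : (0 : ℝ) < n := by exact_mod_cast hn
  set N : ℝ := (n : ℝ) ^ (d + 1) with hNdef
  have hN0 : 0 < N := by positivity
  set g := gStar n a m2 M ψ with hg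
  set w := (indB n M).mulVec g with hw
  set Q : ↥(boxDom M) → ℝ := N⁻¹ • w with hQ
  set A : ℝ := ∑ y, (ψ y - N⁻¹ * w y) ^ 2 with hA
  set B : ℝ := g ⬝ᵥ (boxOpR n a m2 M).mulVec g - a * N⁻¹ * ∑ y, w y ^ 2 with hB
  set U : ℝ := ∑ x, ∑ x' ∈ boxNbrs (fun i => n * M i) x, (g x - g x') ^ 2 with hU
  have hF : ψ ⬝ᵥ (Keff n a m2 M).mulVec ψ = a * A + N⁻¹ * B := Keff_form_eq_energy hn ha hm hM ψ
  have hA0 : 0 ≤ A := Finset.sum_nonneg fun _ _ => sq_nonneg _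
  have hU0 : 0 ≤ U := Finset.sum_nonneg fun _ _ => Finset.sum_nonneg fun _ _ => sq_nonneg _
  have hBU : (n : ℝ) ^ 2 / 2 * U ≤ B := fineEnergy_ge hn a hm M g
  have hB0 : 0 ≤ B := le_trans (mul_nonneg (by positivity) hU0) hBU
  -- split ψ = (ψ − Q) + Q
  have hsplit : extB M ψ = extB M (ψ - Q) + extB M Q := by
    rw [← extB_add, sub_add_cancel]
  have hE1 : dirBox M (extB M (ψ - Q)) ≤ 4 * (d + 1) * A := by
    have h := dirBox_extB_le_norm (ψ - Q)
    have hAA : (ψ - Q) ⬝ᵥ (ψ - Q) = A := by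
      rw [hA]
      unfold dotProduct
      refine Finset.sum_congr rfl fun y _ => ?_
      simp only [hQ, Pi.sub_apply, Pi.smul_apply, smul_eq_mul]
      ring
    rw [hAA] at h
    exact h
  have hE2 : dirBox M (extB M Q) ≤ 4 * N⁻¹ * B := by
    have h := dirBox_blockAvg_le hn M g
    calc dirBox M (extB M Q) ≤ 2 * (n : ℝ) ^ 2 * N⁻¹ * U := h
      _ = 4 * N⁻¹ * ((n : ℝ) ^ 2 / 2 * U) := by ring
      _ ≤ 4 * N⁻¹ * B := mul_le_mul_of_nonneg_left hBU (by positivity)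
  have hE : dirBox M (extB M ψ) ≤ 8 * (d + 1) * A + 8 * N⁻¹ * B := by
    rw [hsplit]
    have := dirBox_add_le M (extB M (ψ - Q)) (extB M Q)
    linarith
  -- compare constants
  set c : ℝ := min (a / (8 * (d + 1))) (1 / 8) with hc
  have hc0 : 0 ≤ c := le_min (by positivity) (by norm_num)
  have hc1 : c * (8 * (d + 1)) ≤ a := by
    have : c ≤ a / (8 * (d + 1)) := min_le_left _ _
    have hd : (0 : ℝ) < 8 * (d + 1) := by positivity
    calc c * (8 * (d + 1)) ≤ a / (8 * (d + 1)) * (8 * (d + 1)) := mul_le_mul_of_nonneg_right this hd.le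
      _ = a := div_mul_cancel₀ a hd.ne'
  have hc2 : c * 8 ≤ 1 := by
    have : c ≤ 1 / 8 := min_le_right _ _
    linarith
  rw [hF]
  calc c * dirBox M (extB M ψ) ≤ c * (8 * (d + 1) * A + 8 * N⁻¹ * B) := mul_le_mul_of_nonneg_left hE hc0
    _ = c * (8 * (d + 1)) * A + c * 8 * (N⁻¹ * B) := by ring
    _ ≤ a * A + 1 * (N⁻¹ * B) := by
        gcongr
    _ = a * A + N⁻¹ * B := by ring

/-! ## §5  `C^{(j)}(□)^{-1} = Δ^{(j)}(□) + a L^{-2} P` restricted to the unit box, and its coercivity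

The unit box `□^{(j)} = □ ∩ ℤ^{d+1}` is "built of large blocks": side lengths `L·M′` with `L = ℓ + 1 ≥ 2`; `P` is the
orthogonal projection onto functions constant on `L`-blocks (counting normalisation:
`P(y, y′) = L^{-(d+1)}[y ∼_L y′]`). -/

/-- the block-averaging projection `P(y, y′) = L^{-(d+1)}·[y, y′ in the same L-block]`, `L = ℓ + 1` (the `P` of
p. 573 (1.13): the orthogonal projection onto `L`-block constants, counting measure).
[cite: Balaban1983RegularityDecay, p. 573 (1.13), dictionary] [folklore] -/
def blockAvgP (ℓ : ℕ) (M' : Fin (d + 1) → ℕ) :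
    Matrix ↥(boxDom (fun i => (ℓ + 1) * M' i)) ↥(boxDom (fun i => (ℓ + 1) * M' i)) ℝ :=
  Matrix.of fun y y' => if blk (ℓ + 1) y.1 = blk (ℓ + 1) y'.1 then (((ℓ : ℝ) + 1) ^ (d + 1))⁻¹ else 0

/-- **THE TYPED OBJECT** `C^{(j)}(□)^{-1} = Δ^{(j)}(□) + a₂L^{-2}P` (p. 573 (1.13) with `A = 0`, `Ω = □`,
`Λ = □^{(j)}`), `n = L^j` the number of fine points per unit length, on the unit box of side lengths `L·M′`.
[cite: Balaban1983RegularityDecay, p. 573 (1.13)–(1.14), dictionary] -/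
def covOp (n ℓ : ℕ) (a₁ a₂ m2 : ℝ) (M' : Fin (d + 1) → ℕ) :
    Matrix ↥(boxDom (fun i => (ℓ + 1) * M' i)) ↥(boxDom (fun i => (ℓ + 1) * M' i)) ℝ :=
  Keff n a₁ m2 (fun i => (ℓ + 1) * M' i) + (a₂ / ((ℓ : ℝ) + 1) ^ 2) • blockAvgP ℓ M'

/-- the block-averaging projection `P` is a symmetric matrix. [folklore] -/
theorem blockAvgP_isSymm (ℓ : ℕ) (M' : Fin (d + 1) → ℕ) : (blockAvgP ℓ M').IsSymm := by
  ext y y'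
  simp only [blockAvgP, Matrix.transpose_apply, Matrix.of_apply]
  by_cases h : blk (ℓ + 1) y.1 = blk (ℓ + 1) y'.1
  · rw [if_pos h, if_pos h.symm]
  · rw [if_neg h, if_neg (fun h' => h h'.symm)]

/-- `Δ^{(j)}(□) + a₂L^{-2}P` is a symmetric matrix. [folklore] -/
theorem covOp_isSymm (n ℓ : ℕ) (a₁ a₂ m2 : ℝ) (M' : Fin (d + 1) → ℕ) : (covOp n ℓ a₁ a₂ m2 M').IsSymm := by
  unfold covOp
  exact (Keff_isSymm n a₁ m2 _).add ((blockAvgP_isSymm ℓ M').smul _)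

/-- the `L`-block label of a unit site (a point of the box of blocks). [folklore] -/
def lblk (ℓ : ℕ) (M' : Fin (d + 1) → ℕ) (y : ↥(boxDom (fun i => (ℓ + 1) * M' i))) : ↥(boxDom M') :=
  ⟨blk (ℓ + 1) y.1, blk_mem_boxDom (by omega) y.2⟩

/-- the chart of an `L`-block: offset `j ↦ L·b + j`. [folklore] -/
def lchart (ℓ : ℕ) (M' : Fin (d + 1) → ℕ) (b : ↥(boxDom M')) (j : Fin (d + 1) → Fin (ℓ + 1)) :
    ↥(boxDom (fun i => (ℓ + 1) * M' i)) :=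
  ⟨finePt (ℓ + 1) b.1 j, finePt_mem_boxDom (ℓ + 1) b.2 j⟩

/-- the `L`-block label of a chart point is the block it was charted from. [folklore] -/
theorem lblk_lchart (ℓ : ℕ) (M' : Fin (d + 1) → ℕ) (b : ↥(boxDom M')) (j : Fin (d + 1) → Fin (ℓ + 1)) :
    lblk ℓ M' (lchart ℓ M' b j) = b :=
  Subtype.ext (blk_finePt (by omega) b.1 j)

/-- the `L`-block chart is injective. [folklore] -/
theorem lchart_injective (ℓ : ℕ) (M' : Fin (d + 1) → ℕ) (b : ↥(boxDom M')) :
    Function.Injective (lchart ℓ M' b) := fun _ _ h =>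
  finePt_injective (ℓ + 1) b.1 (congrArg Subtype.val h)

/-- every unit site is a chart point of its own `L`-block. [folklore] -/
theorem lchart_surj (ℓ : ℕ) (M' : Fin (d + 1) → ℕ) (y : ↥(boxDom (fun i => (ℓ + 1) * M' i))) :
    ∃ j, lchart ℓ M' (lblk ℓ M' y) j = y := by
  obtain ⟨j, hj⟩ := finePt_offset_of_blk (n := ℓ + 1) (by omega) (rfl : blk (ℓ + 1) y.1 = (lblk ℓ M' y).1)
  exact ⟨j, Subtype.ext hj⟩

/-- the coordinate step inside a block: `L·b + stepUp j μ = (L·b + j) + e_μ` when `j μ ≠ last`. [folklore] -/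
theorem finePt_stepUp (ℓ : ℕ) (y : Fin (d + 1) → ℤ) (j : Fin (d + 1) → Fin (ℓ + 1)) (μ : Fin (d + 1))
    (h : j μ ≠ Fin.last ℓ) : finePt (ℓ + 1) y (stepUp j μ) = finePt (ℓ + 1) y j + uvec μ := by
  have hlt : j μ < Fin.last ℓ := lt_of_le_of_ne (Fin.le_last _) h
  have hval : ((j μ + 1 : Fin (ℓ + 1)) : ℕ) = (j μ : ℕ) + 1 := Fin.val_add_one_of_lt hlt
  funext i
  rw [Pi.add_apply, finePt_apply, finePt_apply]
  unfold stepUp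
  by_cases hi : i = μ
  · subst hi
    rw [Function.update_self, uvec_apply_same, hval]
    push_cast
    ring
  · rw [Function.update_of_ne hi, uvec_apply_ne hi, add_zero]

/-- a coordinate step from a non-last chart offset stays in the unit box. [folklore] -/
theorem lchart_step_mem {ℓ : ℕ} {M' : Fin (d + 1) → ℕ} (b : ↥(boxDom M')) {j : Fin (d + 1) → Fin (ℓ + 1)}
    {μ : Fin (d + 1)} (h : j μ ≠ Fin.last ℓ) :
    (lchart ℓ M' b j).1 + uvec μ ∈ boxDom (fun i => (ℓ + 1) * M' i) := by
  show finePt (ℓ + 1) b.1 j + uvec μ ∈ _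
  rw [← finePt_stepUp ℓ b.1 j μ h]
  exact finePt_mem_boxDom (ℓ + 1) b.2 _

/-- `0 ≠ last` in `Fin (ℓ+1)` when `ℓ ≥ 1`. [folklore] -/
theorem zero_ne_last {ℓ : ℕ} (hℓ : 1 ≤ ℓ) : (0 : Fin (ℓ + 1)) ≠ Fin.last ℓ := by
  intro h
  have := congrArg Fin.val h
  rw [Fin.val_zero, Fin.val_last] at this
  omega

/-- the bond listing of an `L`-block: the internal step `⟨L·b + j, L·b + j + e_μ⟩` (for `j μ ≠ last`; a fixed
valid bond otherwise). [folklore] -/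
def lbond (ℓ : ℕ) (hℓ : 1 ≤ ℓ) (M' : Fin (d + 1) → ℕ) (b : ↥(boxDom M')) (μ : Fin (d + 1))
    (j : Fin (d + 1) → Fin (ℓ + 1)) : UBond (fun i => (ℓ + 1) * M' i) :=
  if h : j μ ≠ Fin.last ℓ then ⟨(lchart ℓ M' b j, μ), lchart_step_mem b h⟩
  else ⟨(lchart ℓ M' b (Function.update j μ 0), μ),
    lchart_step_mem b (j := Function.update j μ 0)
      (by rw [Function.update_self]; exact zero_ne_last hℓ)⟩

/-- the bond attached to a non-last offset is the genuine bond `⟨L·b + j, μ⟩`. [folklore] -/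
theorem lbond_pos {ℓ : ℕ} (hℓ : 1 ≤ ℓ) {M' : Fin (d + 1) → ℕ} (b : ↥(boxDom M')) {μ : Fin (d + 1)}
    {j : Fin (d + 1) → Fin (ℓ + 1)} (h : j μ ≠ Fin.last ℓ) :
    lbond ℓ hℓ M' b μ j = ⟨(lchart ℓ M' b j, μ), lchart_step_mem b h⟩ := dif_pos h

/-- **POINCARÉ ON EVERY `L`-BLOCK** with constant `ℓ(ℓ+1)/2`, relative to the unit bonds inside the block
(`Beta.CoordCubePoincare.blockPoincare_of_charts`). [folklore] -/
theorem lblock_poincare {ℓ : ℕ} (hℓ : 1 ≤ ℓ) (M' : Fin (d + 1) → ℕ) (b : ↥(boxDom M'))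
    (f : ↥(boxDom (fun i => (ℓ + 1) * M' i)) → ℝ) :
    ∑ i ∈ Finset.univ.filter (fun i => lblk ℓ M' i = b),
        (f i - avg (Finset.univ.filter fun i => lblk ℓ M' i = b) f) ^ 2
      ≤ (ℓ : ℝ) * (ℓ + 1) / 2 *
        ∑ k ∈ Finset.univ.filter (fun k : UBond (fun i => (ℓ + 1) * M' i) =>
          lblk ℓ M' (bsrc k) = b ∧ lblk ℓ M' (btgt k) = b), (f (btgt k) - f (bsrc k)) ^ 2 := by
  refine blockPoincare_of_charts (lblk ℓ M') bsrc btgt ℓ (d + 1) (lchart ℓ M') (lblk_lchart ℓ M')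
    (lchart_injective ℓ M') (lchart_surj ℓ M') (lbond ℓ hℓ M') ?_ ?_ ?_ b f
  · intro b μ j h
    rw [lbond_pos hℓ b h]
    rfl
  · intro b μ j h
    rw [lbond_pos hℓ b h]
    apply Subtype.ext
    show (lchart ℓ M' b j).1 + uvec μ = (lchart ℓ M' b (stepUp j μ)).1
    exact (finePt_stepUp ℓ b.1 j μ h).symm
  · intro b p hp q hq hpq
    simp only [Set.mem_setOf_eq] at hp hq
    have h1 : lbond ℓ hℓ M' b p.1 p.2 = lbond ℓ hℓ M' b q.1 q.2 := hpq
    rw [lbond_pos hℓ b hp, lbond_pos hℓ b hq] at h1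
    have h2 := congrArg Subtype.val h1
    simp only [Prod.mk.injEq] at h2
    exact Prod.ext h2.2 (lchart_injective ℓ M' b h2.1)

/-- every `L`-block of the unit box has exactly `L^{d+1}` sites. [folklore] -/
theorem card_filter_lblk (ℓ : ℕ) (M' : Fin (d + 1) → ℕ) (b : ↥(boxDom M')) :
    (Finset.univ.filter (fun y => lblk ℓ M' y = b)).card = (ℓ + 1) ^ (d + 1) := by
  rw [← card_filter_blk (n := ℓ + 1) (by omega) M' b]
  congr 1
  refine Finset.filter_congr fun y _ => ?_
  exact Subtype.ext_iff

/-- **THE BLOCK FORM OF `P`**: `⟨ω, Pω⟩ = Σ_b |b|·(avg_b ω)²`. [folklore] -/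
theorem blockAvgP_form (ℓ : ℕ) (M' : Fin (d + 1) → ℕ) (ω : ↥(boxDom (fun i => (ℓ + 1) * M' i)) → ℝ) :
    ω ⬝ᵥ (blockAvgP ℓ M').mulVec ω
      = ∑ b : ↥(boxDom M'), ((Finset.univ.filter (fun y => lblk ℓ M' y = b)).card : ℝ)
          * avg (Finset.univ.filter fun y => lblk ℓ M' y = b) ω ^ 2 := by
  have h1 : ω ⬝ᵥ (blockAvgP ℓ M').mulVec ω = ∑ y, ∑ y',
      (if blk (ℓ + 1) y.1 = blk (ℓ + 1) y'.1 then (((ℓ : ℝ) + 1) ^ (d + 1))⁻¹ else 0) * (ω y * ω y') := by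
    simp only [dotProduct, Matrix.mulVec, blockAvgP, Matrix.of_apply, Finset.mul_sum]
    exact Finset.sum_congr rfl fun y _ => Finset.sum_congr rfl fun y' _ => by ring
  rw [h1, ← Finset.sum_fiberwise_of_maps_to (s := Finset.univ) (t := Finset.univ) (g := lblk ℓ M')
    (fun y _ => Finset.mem_univ _)]
  refine Finset.sum_congr rfl fun b _ => ?_
  have h2 : ∀ y ∈ Finset.univ.filter (fun y => lblk ℓ M' y = b),
      ∑ y', (if blk (ℓ + 1) y.1 = blk (ℓ + 1) y'.1 then (((ℓ : ℝ) + 1) ^ (d + 1))⁻¹ else 0) * (ω y * ω y')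
        = (((ℓ : ℝ) + 1) ^ (d + 1))⁻¹ * ω y
            * ∑ y' ∈ Finset.univ.filter (fun y' => lblk ℓ M' y' = b), ω y' := by
    intro y hy
    have hyb : blk (ℓ + 1) y.1 = b.1 := congrArg Subtype.val (Finset.mem_filter.1 hy).2
    rw [Finset.mul_sum, Finset.sum_filter]
    refine Finset.sum_congr rfl fun y' _ => ?_
    have hiff : blk (ℓ + 1) y.1 = blk (ℓ + 1) y'.1 ↔ lblk ℓ M' y' = b := by
      rw [Subtype.ext_iff, hyb]
      show b.1 = blk (ℓ + 1) y'.1 ↔ blk (ℓ + 1) y'.1 = b.1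
      exact eq_comm
    by_cases hc : lblk ℓ M' y' = b
    · rw [if_pos (hiff.2 hc), if_pos hc]
      ring
    · rw [if_neg (fun h => hc (hiff.1 h)), if_neg hc]
      ring
  rw [Finset.sum_congr rfl h2, ← Finset.sum_mul, ← Finset.mul_sum]
  have h3 := blockTerm_eq (lblk ℓ M') 1 ω b
  rw [one_mul] at h3
  rw [← h3, card_filter_lblk]
  push_cast
  ring

/-- **COERCIVITY OF `C^{(j)}(□)^{-1}`** (the lower half of (1.15) for `Λ = □^{(j)}`, `A = 0`):
`⟨ω, (Δ^{(j)}(□) + a₂L^{-2}P)ω⟩ ≥ γ₀‖ω‖²`, `γ₀ = min(min(a₁/(8(d+1)), 1/8)/(ℓ(ℓ+1)/2), a₂/L²) > 0`, uniformly in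
`n = L^j` and in the box. [folklore] -/
theorem covOp_form_ge {n ℓ : ℕ} (hn : 1 ≤ n) (hℓ : 1 ≤ ℓ) {a₁ a₂ m2 : ℝ} (ha : 0 < a₁) (ha2 : 0 ≤ a₂)
    (hm : 0 ≤ m2) {M' : Fin (d + 1) → ℕ} (hM : ∀ i, 1 ≤ M' i)
    (ω : ↥(boxDom (fun i => (ℓ + 1) * M' i)) → ℝ) :
    min (min (a₁ / (8 * (d + 1))) (1 / 8) / ((ℓ : ℝ) * (ℓ + 1) / 2)) (a₂ / ((ℓ : ℝ) + 1) ^ 2) * (ω ⬝ᵥ ω)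
      ≤ ω ⬝ᵥ (covOp n ℓ a₁ a₂ m2 M').mulVec ω := by
  have hℓ1 : (1 : ℝ) ≤ ℓ := by exact_mod_cast hℓ
  have hP : (0 : ℝ) < (ℓ : ℝ) * (ℓ + 1) / 2 := by positivity
  have hMℓ : ∀ i, 1 ≤ (ℓ + 1) * M' i := fun i => by nlinarith [hM i]
  refine coercive_of_blockPoincare (lblk ℓ M') bsrc btgt _ hP (lblock_poincare hℓ M')
    (covOp n ℓ a₁ a₂ m2 M') _ _ (le_min (by positivity) (by norm_num)) (by positivity) ?_ ω
  intro ω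
  rw [sum_UBond_eq_dirBox, ← blockAvgP_form]
  have hK := Keff_form_ge hn ha hm (M := fun i => (ℓ + 1) * M' i) hMℓ ω
  unfold covOp
  rw [Matrix.add_mulVec, dotProduct_add, Matrix.smul_mulVec, dotProduct_smul, smul_eq_mul]
  linarith

/-- `Δ^{(j)}(□) + a₂L^{-2}P` is invertible on the unit box (coercivity), so `(covOp …)⁻¹` below is its genuine
inverse `C^{(j)}(□)`, not Mathlib's junk value. [folklore] -/
theorem covOp_isUnit {n ℓ : ℕ} (hn : 1 ≤ n) (hℓ : 1 ≤ ℓ) {a₁ a₂ m2 : ℝ} (ha : 0 < a₁) (ha2 : 0 < a₂)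
    (hm : 0 ≤ m2) {M' : Fin (d + 1) → ℕ} (hM : ∀ i, 1 ≤ M' i) : IsUnit (covOp n ℓ a₁ a₂ m2 M') := by
  have hℓ1 : (1 : ℝ) ≤ ℓ := by exact_mod_cast hℓ
  refine QGQInverse.isUnit_of_coercive
    (γ := min (min (a₁ / (8 * (d + 1))) (1 / 8) / ((ℓ : ℝ) * (ℓ + 1) / 2)) (a₂ / ((ℓ : ℝ) + 1) ^ 2))
    (lt_min (by positivity) (by positivity)) ?_
  intro ω
  exact covOp_form_ge hn hℓ ha ha2.le hm hM ω

/-- `covOp · covOp⁻¹ = 1` on the window: the nonsingular inverse `C^{(j)}(□)` is a genuine inverse. [folklore] -/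
theorem covOp_mul_inv {n ℓ : ℕ} (hn : 1 ≤ n) (hℓ : 1 ≤ ℓ) {a₁ a₂ m2 : ℝ} (ha : 0 < a₁) (ha2 : 0 < a₂)
    (hm : 0 ≤ m2) {M' : Fin (d + 1) → ℕ} (hM : ∀ i, 1 ≤ M' i) :
    covOp n ℓ a₁ a₂ m2 M' * (covOp n ℓ a₁ a₂ m2 M')⁻¹ = 1 :=
  Matrix.mul_nonsing_inv _ ((Matrix.isUnit_iff_isUnit_det _).1 (covOp_isUnit hn hℓ ha ha2 hm hM))

/-- **BOUNDEDNESS OF `C^{(j)}(□)^{-1}`** (the upper half of (1.15)): `⟨ω, (Δ^{(j)}(□) + a₂L^{-2}P)ω⟩ ≤ (a₁ + a₂/L²)‖ω‖²`.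
[folklore] -/
theorem covOp_form_le {n ℓ : ℕ} (hn : 1 ≤ n) {a₁ a₂ m2 : ℝ} (ha : 0 < a₁) (ha2 : 0 ≤ a₂) (hm : 0 ≤ m2)
    {M' : Fin (d + 1) → ℕ} (hM : ∀ i, 1 ≤ M' i) (ω : ↥(boxDom (fun i => (ℓ + 1) * M' i)) → ℝ) :
    ω ⬝ᵥ (covOp n ℓ a₁ a₂ m2 M').mulVec ω ≤ (a₁ + a₂ / ((ℓ : ℝ) + 1) ^ 2) * (ω ⬝ᵥ ω) := by
  have hMℓ : ∀ i, 1 ≤ (ℓ + 1) * M' i := fun i => by nlinarith [hM i]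
  have hK := Keff_form_le hn ha hm (M := fun i => (ℓ + 1) * M' i) hMℓ ω
  have hPle : ω ⬝ᵥ (blockAvgP ℓ M').mulVec ω ≤ ω ⬝ᵥ ω := by
    rw [blockAvgP_form]
    have hn2 : ω ⬝ᵥ ω = ∑ y, ω y ^ 2 := by
      unfold dotProduct
      exact Finset.sum_congr rfl fun y _ => by ring
    rw [hn2, ← Finset.sum_fiberwise_of_maps_to (s := Finset.univ) (t := Finset.univ) (g := lblk ℓ M')
      (fun y _ => Finset.mem_univ _) (f := fun y => ω y ^ 2)]
    exact Finset.sum_le_sum fun b _ => card_mul_avg_sq_le _ ω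
  unfold covOp
  rw [Matrix.add_mulVec, dotProduct_add, Matrix.smul_mulVec, dotProduct_smul, smul_eq_mul, add_mul]
  have : a₂ / ((ℓ : ℝ) + 1) ^ 2 * (ω ⬝ᵥ (blockAvgP ℓ M').mulVec ω) ≤ a₂ / ((ℓ : ℝ) + 1) ^ 2 * (ω ⬝ᵥ ω) :=
    mul_le_mul_of_nonneg_left hPle (by positivity)
  linarith

/-! ## §6  Entry bounds: `|C^{(j)}(□)^{-1}(y, y′)| ≤ c₀e^{−κ|y − y′|}`

From the lineage's hypothesis-free first estimate of (2.35) (`B4Green242Bridge.greenBoxQ_decay_235_inv`: the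
block-row sums of `G_j(□)` decay exponentially in the sup norm of the unit labels), the block–block sums of
`G_j(□)` — the entries of `Q_jG_j(□)Q_j^*` up to the factor `N = n^{d+1}` — decay at the same rate; `a_jI` is
diagonal and `P` has range `ℓ` (same `L`-block). -/

/-- the sup norm of `0 ∈ ℤ^{d+1}` is `0`. [folklore] -/
theorem supNorm_zero' : supNorm (0 : Fin (d + 1) → ℤ) = 0 :=
  le_antisymm (supNorm_le_of_forall fun i => by simp) (supNorm_nonneg _)

/-- the complex block-row sums of `G_j(□)` are the real ones. [folklore] -/
theorem blockRowSum_real {n : ℕ} (hn : 1 ≤ n) {a m2 : ℝ} (ha : 0 < a) (hm : 0 ≤ m2) {M : Fin (d + 1) → ℕ}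
    (hM : ∀ i, 1 ≤ M i) (x : ↥(boxDom (fun i => n * M i))) (y : Fin (d + 1) → ℤ) :
    (∑ x' : ↥(boxDom (fun i => n * M i)), (if blk n x'.1 = y then (boxOp n a m2 M)⁻¹ x x' else 0))
      = (((∑ x' : ↥(boxDom (fun i => n * M i)), (if blk n x'.1 = y then (boxOpR n a m2 M)⁻¹ x x' else 0)) : ℝ)
          : ℂ) := by
  rw [boxOp_inv_eq_map hn ha hm hM]
  push_cast
  refine Finset.sum_congr rfl fun x' _ => ?_
  split_ifs
  · rfl
  · simp

/-- **BLOCK–BLOCK SUMS OF `G_j(□)` DECAY**: `|Σ_{x ∈ B(y)} Σ_{x′ ∈ B(y′)} G_j(□)(x, x′)| ≤ N·C·e^{−κ|y−y′|}`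
uniformly over the parameter window (`N = n^{d+1}` sites per block). [folklore] -/
theorem green_blockSum_bound (d : ℕ) (aminus aplus m2plus : ℝ) (ha : 0 < aminus) :
    ∃ κ C : ℝ, 0 < κ ∧ 0 ≤ C ∧ ∀ (n : ℕ), 1 ≤ n → ∀ (a m2 : ℝ), aminus ≤ a → a ≤ aplus → 0 ≤ m2 → m2 ≤ m2plus →
      ∀ (M : Fin (d + 1) → ℕ), (∀ i, 1 ≤ M i) → ∀ y y' : ↥(boxDom M),
        |(indB n M * (boxOpR n a m2 M)⁻¹ * (indB n M)ᵀ) y y'|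
          ≤ (n : ℝ) ^ (d + 1) * C * Real.exp (-(κ * supNorm (y.1 - y'.1))) := by
  obtain ⟨κ, C, hκ, hC, h⟩ := greenBoxQ_decay_235_inv d aminus aplus m2plus ha
  refine ⟨κ, C, hκ, hC, fun n hn a m2 h1 h2 h3 h4 M hM y y' => ?_⟩
  have ha' : 0 < a := lt_of_lt_of_le ha h1
  rw [indB_mul_mul_transpose_apply]
  have hrow : ∀ x ∈ Finset.univ.filter (fun x : ↥(boxDom (fun i => n * M i)) => blk n x.1 = y.1),
      |∑ x' ∈ Finset.univ.filter (fun x' : ↥(boxDom (fun i => n * M i)) => blk n x'.1 = y'.1),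
          (boxOpR n a m2 M)⁻¹ x x'| ≤ C * Real.exp (-(κ * supNorm (y.1 - y'.1))) := by
    intro x hx
    have hxy : blk n x.1 = y.1 := (Finset.mem_filter.1 hx).2
    have hb := (h n hn a m2 h1 h2 h3 h4 M hM).2 x y'.1 y'.2
    rw [hxy, blockRowSum_real hn ha' h3 hM, Complex.norm_real, Real.norm_eq_abs, ← Finset.sum_filter] at hb
    exact hb
  calc |∑ x ∈ Finset.univ.filter (fun x : ↥(boxDom (fun i => n * M i)) => blk n x.1 = y.1),
          ∑ x' ∈ Finset.univ.filter (fun x' : ↥(boxDom (fun i => n * M i)) => blk n x'.1 = y'.1),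
            (boxOpR n a m2 M)⁻¹ x x'|
      ≤ ∑ x ∈ Finset.univ.filter (fun x : ↥(boxDom (fun i => n * M i)) => blk n x.1 = y.1),
          |∑ x' ∈ Finset.univ.filter (fun x' : ↥(boxDom (fun i => n * M i)) => blk n x'.1 = y'.1),
            (boxOpR n a m2 M)⁻¹ x x'| := Finset.abs_sum_le_sum_abs _ _
    _ ≤ ∑ _x ∈ Finset.univ.filter (fun x : ↥(boxDom (fun i => n * M i)) => blk n x.1 = y.1),
          C * Real.exp (-(κ * supNorm (y.1 - y'.1))) := Finset.sum_le_sum hrow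
    _ = (n : ℝ) ^ (d + 1) * C * Real.exp (-(κ * supNorm (y.1 - y'.1))) := by
        rw [Finset.sum_const, card_filter_blk hn M y, nsmul_eq_mul]
        push_cast
        ring

/-- **ENTRIES OF `Δ^{(j)}(□)` DECAY**: `|Δ^{(j)}(□)(y, y′)| ≤ (a_j + a_j²C)e^{−κ|y−y′|}` uniformly over the window.
[folklore] -/
theorem Keff_entry_bound (d : ℕ) (aminus aplus m2plus : ℝ) (ha : 0 < aminus) :
    ∃ κ C : ℝ, 0 < κ ∧ 0 ≤ C ∧ ∀ (n : ℕ), 1 ≤ n → ∀ (a m2 : ℝ), aminus ≤ a → a ≤ aplus → 0 ≤ m2 → m2 ≤ m2plus →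
      ∀ (M : Fin (d + 1) → ℕ), (∀ i, 1 ≤ M i) → ∀ y y' : ↥(boxDom M),
        |Keff n a m2 M y y'| ≤ (a + a ^ 2 * C) * Real.exp (-(κ * supNorm (y.1 - y'.1))) := by
  obtain ⟨κ, C, hκ, hC, h⟩ := green_blockSum_bound d aminus aplus m2plus ha
  refine ⟨κ, C, hκ, hC, fun n hn a m2 h1 h2 h3 h4 M hM y y' => ?_⟩
  have ha' : 0 < a := lt_of_lt_of_le ha h1
  have hn0 : (0 : ℝ) < n := by exact_mod_cast hn
  have hG := h n hn a m2 h1 h2 h3 h4 M hM y y'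
  have hE : 0 < Real.exp (-(κ * supNorm (y.1 - y'.1))) := Real.exp_pos _
  have hentry : Keff n a m2 M y y' = a * (if y = y' then (1 : ℝ) else 0)
      - a ^ 2 * ((n : ℝ) ^ (d + 1))⁻¹ * (indB n M * (boxOpR n a m2 M)⁻¹ * (indB n M)ᵀ) y y' := by
    simp only [Keff, Matrix.sub_apply, Matrix.smul_apply, Matrix.one_apply, smul_eq_mul]
  have h2 : |a ^ 2 * ((n : ℝ) ^ (d + 1))⁻¹ * (indB n M * (boxOpR n a m2 M)⁻¹ * (indB n M)ᵀ) y y'|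
      ≤ a ^ 2 * C * Real.exp (-(κ * supNorm (y.1 - y'.1))) := by
    rw [abs_mul, abs_of_nonneg (by positivity : (0 : ℝ) ≤ a ^ 2 * ((n : ℝ) ^ (d + 1))⁻¹)]
    have hN : (n : ℝ) ^ (d + 1) ≠ 0 := by positivity
    calc a ^ 2 * ((n : ℝ) ^ (d + 1))⁻¹ * |(indB n M * (boxOpR n a m2 M)⁻¹ * (indB n M)ᵀ) y y'|
        ≤ a ^ 2 * ((n : ℝ) ^ (d + 1))⁻¹ * ((n : ℝ) ^ (d + 1) * C * Real.exp (-(κ * supNorm (y.1 - y'.1)))) :=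
          mul_le_mul_of_nonneg_left hG (by positivity)
      _ = a ^ 2 * C * Real.exp (-(κ * supNorm (y.1 - y'.1))) := by
          field_simp
  have h1 : |a * (if y = y' then (1 : ℝ) else 0)| ≤ a * Real.exp (-(κ * supNorm (y.1 - y'.1))) := by
    by_cases hyy : y = y'
    · subst hyy
      rw [if_pos rfl, mul_one, abs_of_pos ha', sub_self, supNorm_zero', mul_zero, neg_zero, Real.exp_zero, mul_one]
    · rw [if_neg hyy, mul_zero, abs_zero]
      positivity
  rw [hentry]
  calc |a * (if y = y' then (1 : ℝ) else 0)
        - a ^ 2 * ((n : ℝ) ^ (d + 1))⁻¹ * (indB n M * (boxOpR n a m2 M)⁻¹ * (indB n M)ᵀ) y y'|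
      ≤ |a * (if y = y' then (1 : ℝ) else 0)|
        + |a ^ 2 * ((n : ℝ) ^ (d + 1))⁻¹ * (indB n M * (boxOpR n a m2 M)⁻¹ * (indB n M)ᵀ) y y'| := abs_sub _ _
    _ ≤ a * Real.exp (-(κ * supNorm (y.1 - y'.1))) + a ^ 2 * C * Real.exp (-(κ * supNorm (y.1 - y'.1))) :=
        add_le_add h1 h2
    _ = (a + a ^ 2 * C) * Real.exp (-(κ * supNorm (y.1 - y'.1))) := by ring

/-- two sites of one `L`-block are at sup distance `≤ L − 1`. [folklore] -/
theorem supNorm_sub_le_of_blk_eq {L : ℕ} (hL : 1 ≤ L) {y y' : Fin (d + 1) → ℤ} (h : blk L y = blk L y') :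
    supNorm (y - y') ≤ (L : ℝ) - 1 := by
  have hL0 : (0 : ℤ) < L := by exact_mod_cast hL
  refine supNorm_le_of_forall fun i => ?_
  have hq : y i / (L : ℤ) = y' i / (L : ℤ) := congrFun h i
  have h1 := Int.emod_add_ediv_mul (y i) L
  have h2 := Int.emod_add_ediv_mul (y' i) L
  have h3 := Int.emod_nonneg (y i) hL0.ne'
  have h4 := Int.emod_lt_of_pos (y i) hL0
  have h5 := Int.emod_nonneg (y' i) hL0.ne'
  have h6 := Int.emod_lt_of_pos (y' i) hL0
  have h7 : |y i - y' i| ≤ (L : ℤ) - 1 := by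
    rw [abs_le]
    rw [hq] at h1
    constructor <;> linarith
  have h8 : (((|(y - y') i| : ℤ)) : ℝ) ≤ (((L : ℤ) - 1 : ℤ) : ℝ) := by
    rw [Pi.sub_apply]
    exact_mod_cast h7
  have h9 : (((L : ℤ) - 1 : ℤ) : ℝ) = (L : ℝ) - 1 := by push_cast; ring
  rw [h9] at h8
  exact h8

/-- **ENTRIES OF `P` ARE LOCAL**: `|P(y, y′)| ≤ e^{κℓ}e^{−κ|y−y′|}` (`P(y,y′) ≤ 1` vanishes unless `|y − y′| ≤ ℓ`).
[folklore] -/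
theorem blockAvgP_entry_bound (ℓ : ℕ) (M' : Fin (d + 1) → ℕ) {κ : ℝ} (hκ : 0 ≤ κ)
    (y y' : ↥(boxDom (fun i => (ℓ + 1) * M' i))) :
    |blockAvgP ℓ M' y y'| ≤ Real.exp (κ * ℓ) * Real.exp (-(κ * supNorm (y.1 - y'.1))) := by
  simp only [blockAvgP, Matrix.of_apply]
  by_cases h : blk (ℓ + 1) y.1 = blk (ℓ + 1) y'.1
  · rw [if_pos h, abs_of_pos (by positivity)]
    have hs : supNorm (y.1 - y'.1) ≤ ℓ := by
      have := supNorm_sub_le_of_blk_eq (L := ℓ + 1) (by omega) h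
      push_cast at this
      linarith
    have hL1 : (((ℓ : ℝ) + 1) ^ (d + 1))⁻¹ ≤ 1 :=
      inv_le_one_of_one_le₀ (one_le_pow₀ (by linarith [(Nat.cast_nonneg ℓ : (0 : ℝ) ≤ ℓ)]))
    calc (((ℓ : ℝ) + 1) ^ (d + 1))⁻¹ ≤ 1 := hL1
      _ = Real.exp (κ * ℓ) * Real.exp (-(κ * ℓ)) := by rw [← Real.exp_add, add_neg_cancel, Real.exp_zero]
      _ ≤ Real.exp (κ * ℓ) * Real.exp (-(κ * supNorm (y.1 - y'.1))) :=
          mul_le_mul_of_nonneg_left (Real.exp_le_exp.2 (by nlinarith)) (Real.exp_pos _).le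
  · rw [if_neg h, abs_zero]
    positivity

/-! ## §7  Exponential decay of `C^{(j)}(□)` — (2.37), Neumann box, `A = 0`

The sup-distance of the unit labels is a pseudo-distance with the uniform lattice-sum profile
(`B4Sect5Proof.latticeSum_le`); §5–§6 are condition (5.6) of the paper's §5 for `C^{(j)}(□)^{-1}` with constants
uniform in `j` and `□`; the finite Combes–Thomas estimate `B4Sect5Torus.inv_decay` ((5.7) for `A` itself) gives
the decay of the inverse. -/

/-- the sup-distance of unit sites. [folklore] -/
def rho (N : Fin (d + 1) → ℕ) (y y' : ↥(boxDom N)) : ℝ := supNorm (y.1 - y'.1)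

/-- the sup-distance of unit sites is a pseudo-distance (symmetric, zero on the diagonal, triangle inequality). [folklore] -/
theorem rho_isPseudoDist (N : Fin (d + 1) → ℕ) : IsPseudoDist (rho N) where
  symm := fun y y' => by
    unfold rho
    rw [← B4TorusKernel.supNorm_neg, neg_sub]
  zero := fun y => by
    unfold rho
    rw [sub_self]
    exact supNorm_zero'
  triangle := fun x y z => by
    unfold rho
    have := supNorm_add_le (x.1 - y.1) (y.1 - z.1)
    rwa [sub_add_sub_cancel] at this

/-- the uniform lattice-sum profile for the sup-distance on a box. [folklore] -/
theorem rho_sumBound (N : Fin (d + 1) → ℕ) : SumBound (rho N) (latticeConst (d + 1)) := by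
  intro a ha y
  have h1 : ∀ y' : ↥(boxDom N), Real.exp (-(a * rho N y y')) ≤ Real.exp (-(a * dist y.1 y'.1)) := by
    intro y'
    apply Real.exp_le_exp.2
    have : dist y.1 y'.1 ≤ rho N y y' := by
      unfold rho
      rw [dist_pi_le_iff (supNorm_nonneg _)]
      intro i
      rw [Int.dist_eq]
      have := abs_le_supNorm (y.1 - y'.1) i
      rw [Pi.sub_apply] at this
      push_cast at this
      exact this
    nlinarith
  calc ∑ y', Real.exp (-(a * rho N y y'))
      ≤ ∑ y' : ↥(boxDom N), Real.exp (-(a * dist y.1 y'.1)) := Finset.sum_le_sum fun y' _ => h1 y'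
    _ = ∑ z ∈ boxDom N, Real.exp (-(a * dist y.1 z)) :=
        Finset.sum_coe_sort (boxDom N) (fun z => Real.exp (-(a * dist y.1 z)))
    _ ≤ latticeConst (d + 1) a := latticeSum_le (d + 1) ha (boxDom N) y.1

/-- **B4 LEMMA 2.4, THIRD QUANTITY (2.37) — `|C^{(j)}(□; y, y′)| ≤ c₀e^{−δ₀|y−y′|}` — for the Neumann box with
`A = 0`, `Λ = □^{(j)}`, HYPOTHESIS-FREE.**  For every dimension `d + 1`, block size `L = ℓ + 1 ≥ 2` and parameter
window there are `δ, c > 0` such that for EVERY `j` (`n = L^j ≥ 1` fine points per unit length — indeed every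
`n ≥ 1`), every `a_j ∈ [a₋, a₊]`, `m_j² ∈ [0, m₊²]`, `a ∈ [a₂₋, a₂₊]` and EVERY rectangular parallelepiped `□` built
of `L`-blocks (unit box of side lengths `L·M′`), the kernel of `C^{(j)}(□) = (Δ^{(j)}(□) + aL^{-2}P)^{-1}` satisfies
`|C^{(j)}(□; y, y′)| ≤ c·e^{−δ|y − y′|_∞}` (and `Δ^{(j)}(□) + aL^{-2}P` is invertible, so `⁻¹` is the genuine
inverse).  See the module docstring for WHAT IS PRINTED and the HONEST SCOPE.
[cite: Balaban1983RegularityDecay, p. 582 Lemma 2.4 (2.37) («|C^{(j)}(□; y, y′)| ≤ c₀e^{−δ₀|y−y′|}»), p. 584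
(«the inequality (2.37) concerning C^{(j)}(□) is a special case of Proposition 2.3»), p. 574 Proposition 2.3
(1.15)–(1.16), p. 573 (1.13)–(1.14)] -/
theorem cov237_box_decay (d ℓ : ℕ) (hℓ : 1 ≤ ℓ) (aminus aplus m2plus a2minus a2plus : ℝ) (ha : 0 < aminus)
    (ha2 : 0 < a2minus) :
    ∃ δ c : ℝ, 0 < δ ∧ 0 < c ∧ ∀ (n : ℕ), 1 ≤ n → ∀ (a₁ m2 a₂ : ℝ), aminus ≤ a₁ → a₁ ≤ aplus → 0 ≤ m2 →
      m2 ≤ m2plus → a2minus ≤ a₂ → a₂ ≤ a2plus → ∀ (M' : Fin (d + 1) → ℕ), (∀ i, 1 ≤ M' i) →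
        covOp n ℓ a₁ a₂ m2 M' * (covOp n ℓ a₁ a₂ m2 M')⁻¹ = 1 ∧
        ∀ y y' : ↥(boxDom (fun i => (ℓ + 1) * M' i)),
          |(covOp n ℓ a₁ a₂ m2 M')⁻¹ y y'| ≤ c * Real.exp (-(δ * supNorm (y.1 - y'.1))) := by
  obtain ⟨κ, C, hκ, hC, hK⟩ := Keff_entry_bound d aminus aplus m2plus ha
  set γ₀ : ℝ := min (min (aminus / (8 * (d + 1))) (1 / 8) / ((ℓ : ℝ) * (ℓ + 1) / 2))
    (a2minus / ((ℓ : ℝ) + 1) ^ 2) with hγ₀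
  set c₀ : ℝ := |aplus| + aplus ^ 2 * C + |a2plus| * Real.exp (κ * ℓ) with hc₀
  have hℓ1 : (1 : ℝ) ≤ ℓ := by exact_mod_cast hℓ
  have hP : (0 : ℝ) < (ℓ : ℝ) * (ℓ + 1) / 2 := by positivity
  have hγ : 0 < γ₀ := lt_min (by positivity) (by positivity)
  have hc : 0 ≤ c₀ := by positivity
  have hKn : ∀ a : ℝ, 0 < a → 0 ≤ latticeConst (d + 1) a := fun a ha => latticeConst_nonneg (d + 1) ha.le
  refine ⟨rate (latticeConst (d + 1)) γ₀ c₀ κ, 2 / γ₀, rate_pos hKn hγ hc hκ, by positivity, ?_⟩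
  intro n hn a₁ m2 a₂ h1 h2 h3 h4 h5 h6 M' hM
  have ha₁ : 0 < a₁ := lt_of_lt_of_le ha h1
  have ha₂ : 0 ≤ a₂ := le_trans ha2.le h5
  have hMℓ : ∀ i, 1 ≤ (ℓ + 1) * M' i := fun i => by nlinarith [hM i]
  have hA : Hyp56 (rho (fun i => (ℓ + 1) * M' i)) (covOp n ℓ a₁ a₂ m2 M') γ₀ c₀ κ := by
    refine ⟨covOp_isSymm n ℓ a₁ a₂ m2 M', fun v => ?_, fun p q => ?_⟩
    · have hge := covOp_form_ge hn hℓ ha₁ ha₂ h3 hM v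
      have hγle : γ₀ ≤ min (min (a₁ / (8 * (d + 1))) (1 / 8) / ((ℓ : ℝ) * (ℓ + 1) / 2))
          (a₂ / ((ℓ : ℝ) + 1) ^ 2) := by
        apply min_le_min
        · apply div_le_div_of_nonneg_right _ hP.le
          exact min_le_min (div_le_div_of_nonneg_right h1 (by positivity)) le_rfl
        · exact div_le_div_of_nonneg_right h5 (by positivity)
      have hvv : ∑ p, v p ^ 2 = v ⬝ᵥ v := by
        unfold dotProduct
        exact Finset.sum_congr rfl fun p _ => by ring
      have hvv0 : 0 ≤ v ⬝ᵥ v := by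
        rw [← hvv]
        exact Finset.sum_nonneg fun _ _ => sq_nonneg _
      rw [hvv]
      show γ₀ * (v ⬝ᵥ v) ≤ v ⬝ᵥ (covOp n ℓ a₁ a₂ m2 M').mulVec v
      exact (mul_le_mul_of_nonneg_right hγle hvv0).trans hge
    · unfold rho
      have hKe := hK n hn a₁ m2 h1 h2 h3 h4 (fun i => (ℓ + 1) * M' i) hMℓ p q
      have hPe := blockAvgP_entry_bound ℓ M' hκ.le p q
      have hE := Real.exp_pos (-(κ * supNorm (p.1 - q.1)))
      have hL2 : a₂ / ((ℓ : ℝ) + 1) ^ 2 ≤ |a2plus| :=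
        calc a₂ / ((ℓ : ℝ) + 1) ^ 2 ≤ a₂ := div_le_self ha₂ (one_le_pow₀ (by linarith))
          _ ≤ a2plus := h6
          _ ≤ |a2plus| := le_abs_self _
      have hK2 : a₁ + a₁ ^ 2 * C ≤ |aplus| + aplus ^ 2 * C := by
        have hsq : a₁ ^ 2 ≤ aplus ^ 2 := pow_le_pow_left₀ ha₁.le h2 2
        have habs : a₁ ≤ |aplus| := h2.trans (le_abs_self _)
        nlinarith
      have hentry : covOp n ℓ a₁ a₂ m2 M' p q
          = Keff n a₁ m2 (fun i => (ℓ + 1) * M' i) p q + a₂ / ((ℓ : ℝ) + 1) ^ 2 * blockAvgP ℓ M' p q := by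
        simp only [covOp, Matrix.add_apply, Matrix.smul_apply, smul_eq_mul]
      rw [hentry]
      calc |Keff n a₁ m2 (fun i => (ℓ + 1) * M' i) p q + a₂ / ((ℓ : ℝ) + 1) ^ 2 * blockAvgP ℓ M' p q|
          ≤ |Keff n a₁ m2 (fun i => (ℓ + 1) * M' i) p q| + |a₂ / ((ℓ : ℝ) + 1) ^ 2 * blockAvgP ℓ M' p q| :=
            abs_add_le _ _
        _ ≤ (a₁ + a₁ ^ 2 * C) * Real.exp (-(κ * supNorm (p.1 - q.1)))
            + a₂ / ((ℓ : ℝ) + 1) ^ 2 * (Real.exp (κ * ℓ) * Real.exp (-(κ * supNorm (p.1 - q.1)))) := by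
            refine add_le_add hKe ?_
            rw [abs_mul, abs_of_nonneg (by positivity : (0 : ℝ) ≤ a₂ / ((ℓ : ℝ) + 1) ^ 2)]
            exact mul_le_mul_of_nonneg_left hPe (by positivity)
        _ ≤ (|aplus| + aplus ^ 2 * C) * Real.exp (-(κ * supNorm (p.1 - q.1)))
            + |a2plus| * (Real.exp (κ * ℓ) * Real.exp (-(κ * supNorm (p.1 - q.1)))) :=
            add_le_add (mul_le_mul_of_nonneg_right hK2 hE.le)
              (mul_le_mul_of_nonneg_right hL2 (by positivity))
        _ = c₀ * Real.exp (-(κ * supNorm (p.1 - q.1))) := by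
            rw [hc₀]
            ring
  exact ⟨covOp_mul_inv hn hℓ ha₁ (lt_of_lt_of_le ha2 h5) h3 hM,
    fun y y' => inv_decay hKn hγ hc hκ (rho_isPseudoDist _) (rho_sumBound _) hA y y'⟩

/-- **B4 PROPOSITION 2.3 (1.15) FOR THE BOX, `A = 0`, `Λ = □^{(j)}` — `γ₀I ≤ Δ^{(j)}(□) + aL^{-2}P ≤ γ₁I` —
HYPOTHESIS-FREE**, with `γ₀, γ₁` depending on `d`, `ℓ` and the parameter window only (uniform in `j` and `□`).
[cite: Balaban1983RegularityDecay, p. 574 Proposition 2.3 (1.15) («γ₀I ≤ Δ^{(k)}(Ω,A) + aL^{−2}P(A) ≤ γ₁I»),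
p. 584 («(2.37) concerning C^{(j)}(□) is a special case of Proposition 2.3»)] -/
theorem cov237_box_form_bounds (d ℓ : ℕ) (hℓ : 1 ≤ ℓ) (aminus aplus a2minus a2plus : ℝ) (ha : 0 < aminus)
    (ha2 : 0 < a2minus) :
    ∃ γ₀ γ₁ : ℝ, 0 < γ₀ ∧ γ₀ ≤ γ₁ ∧ ∀ (n : ℕ), 1 ≤ n → ∀ (a₁ m2 a₂ : ℝ), aminus ≤ a₁ → a₁ ≤ aplus → 0 ≤ m2 →
      a2minus ≤ a₂ → a₂ ≤ a2plus → ∀ (M' : Fin (d + 1) → ℕ), (∀ i, 1 ≤ M' i) →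
        ∀ ω : ↥(boxDom (fun i => (ℓ + 1) * M' i)) → ℝ,
          γ₀ * (ω ⬝ᵥ ω) ≤ ω ⬝ᵥ (covOp n ℓ a₁ a₂ m2 M').mulVec ω
            ∧ ω ⬝ᵥ (covOp n ℓ a₁ a₂ m2 M').mulVec ω ≤ γ₁ * (ω ⬝ᵥ ω) := by
  set γ₀ : ℝ := min (min (aminus / (8 * (d + 1))) (1 / 8) / ((ℓ : ℝ) * (ℓ + 1) / 2))
    (a2minus / ((ℓ : ℝ) + 1) ^ 2) with hγ₀
  have hℓ1 : (1 : ℝ) ≤ ℓ := by exact_mod_cast hℓ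
  have hP : (0 : ℝ) < (ℓ : ℝ) * (ℓ + 1) / 2 := by positivity
  have hγ : 0 < γ₀ := lt_min (by positivity) (by positivity)
  refine ⟨γ₀, max γ₀ (|aplus| + |a2plus|), hγ, le_max_left _ _, ?_⟩
  intro n hn a₁ m2 a₂ h1 h2 h3 h5 h6 M' hM ω
  have ha₁ : 0 < a₁ := lt_of_lt_of_le ha h1
  have ha₂ : 0 ≤ a₂ := le_trans ha2.le h5
  have hvv0 : 0 ≤ ω ⬝ᵥ ω := by
    unfold dotProduct
    exact Finset.sum_nonneg fun _ _ => mul_self_nonneg _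
  constructor
  · have hge := covOp_form_ge hn hℓ ha₁ ha₂ h3 hM ω
    have hγle : γ₀ ≤ min (min (a₁ / (8 * (d + 1))) (1 / 8) / ((ℓ : ℝ) * (ℓ + 1) / 2))
        (a₂ / ((ℓ : ℝ) + 1) ^ 2) := by
      apply min_le_min
      · apply div_le_div_of_nonneg_right _ hP.le
        exact min_le_min (div_le_div_of_nonneg_right h1 (by positivity)) le_rfl
      · exact div_le_div_of_nonneg_right h5 (by positivity)
    exact (mul_le_mul_of_nonneg_right hγle hvv0).trans hge
  · have hle := covOp_form_le hn ha₁ ha₂ h3 hM ω (ℓ := ℓ)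
    have hL2 : a₁ + a₂ / ((ℓ : ℝ) + 1) ^ 2 ≤ max γ₀ (|aplus| + |a2plus|) := by
      refine le_trans ?_ (le_max_right _ _)
      have : a₂ / ((ℓ : ℝ) + 1) ^ 2 ≤ a₂ := div_le_self ha₂ (one_le_pow₀ (by linarith))
      have := le_abs_self aplus
      have := le_abs_self a2plus
      linarith
    exact hle.trans (mul_le_mul_of_nonneg_right hL2 hvv0)

/-- non-vacuity at the physical dimension `d + 1 = 4`, `L = 2`, the window `a_j ∈ [1/2, 2]`, `m_j² ∈ [0, 1]`,
`a ∈ [1/2, 2]`: the constants exist and the bound is a genuine statement about every box and every `j`. -/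
example : ∃ δ c : ℝ, 0 < δ ∧ 0 < c ∧ ∀ (n : ℕ), 1 ≤ n → ∀ (a₁ m2 a₂ : ℝ), (1 / 2 : ℝ) ≤ a₁ → a₁ ≤ 2 → 0 ≤ m2 →
    m2 ≤ 1 → (1 / 2 : ℝ) ≤ a₂ → a₂ ≤ 2 → ∀ (M' : Fin (3 + 1) → ℕ), (∀ i, 1 ≤ M' i) →
      covOp n 1 a₁ a₂ m2 M' * (covOp n 1 a₁ a₂ m2 M')⁻¹ = 1 ∧
      ∀ y y' : ↥(boxDom (fun i => (1 + 1) * M' i)),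
        |(covOp n 1 a₁ a₂ m2 M')⁻¹ y y'| ≤ c * Real.exp (-(δ * supNorm (y.1 - y'.1))) :=
  cov237_box_decay 3 1 le_rfl (1 / 2) 2 1 (1 / 2) 2 (by norm_num) (by norm_num)

/-! ## §8  (1.16) for `Ω = □` and EVERY `Λ ⊆ □^{(j)}` — the compressions `(Δ^{(j)}(□) + aL^{-2}P)|_Λ` (v2)

p. 573 (1.13): `C_Λ^{(k)}(Ω, A) = ((Δ^{(k)}(Ω, A) + aL^{−2}P(A))|_Λ)^{−1}`, «X|_Λ = ΛXΛ»; p. 574 (1.16):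
«|C_Λ^{(k)}(Ω, A; x, x′)| ≤ c₀ exp(−δ₀|x−x′|), x, x′∈Λ» «for arbitrary Λ ⊂ Ω^{(k)} = Ω∩Z^d, Λ being a sum of big blocks
and for e sufficiently small».  Here: `A = 0`, `Ω = □`, and `Λ` the range of an arbitrary injection `e : m → □^{(j)}`.
Condition (5.6) for `Δ^{(j)}(□) + aL^{-2}P` with window-uniform constants (§5–§6, packaged as `covOp_hyp56`) passes
to every compression (`B4Sect5Torus.hyp56_submatrix`), so the compression is invertible (`B4Sect5Torus.isUnit_of_hyp56`)
and its inverse decays with the constants of §7 (`B4Sect5Torus.inv_submatrix_decay`).  No block structure of `Λ` is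
used; nothing is claimed about `A ≠ 0`, where the print's proviso matters. -/

open B4Sect5Torus (hyp56_submatrix inv_submatrix_decay isUnit_of_hyp56)

/-- the compression `X|_Λ = ΛXΛ` of `X = Δ^{(j)}(□) + aL^{-2}P` along an injection `e : m → □^{(j)}` (for a subset
`Λ ⊆ □^{(j)}`: `e` = the inclusion of `Λ`): the principal submatrix on the range of `e`, i.e. the operator on
`ℓ²(Λ)` inverted in (1.13) (with `Ω = □`, `A = 0`).
[cite: Balaban1983RegularityDecay, p. 573 (1.13) with «X|_Λ = ΛXΛ», dictionary] -/
def covOpSub (n ℓ : ℕ) (a₁ a₂ m2 : ℝ) (M' : Fin (d + 1) → ℕ) {m : Type*}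
    (e : m → ↥(boxDom (fun i => (ℓ + 1) * M' i))) : Matrix m m ℝ :=
  (covOp n ℓ a₁ a₂ m2 M').submatrix e e

/-- the compression along `e` has the entries `X(e i, e i′)`. [folklore] -/
@[simp] theorem covOpSub_apply (n ℓ : ℕ) (a₁ a₂ m2 : ℝ) (M' : Fin (d + 1) → ℕ) {m : Type*}
    (e : m → ↥(boxDom (fun i => (ℓ + 1) * M' i))) (i i' : m) :
    covOpSub n ℓ a₁ a₂ m2 M' e i i' = covOp n ℓ a₁ a₂ m2 M' (e i) (e i') := rfl

/-- **Condition (5.6) for `Δ^{(j)}(□) + aL^{-2}P`, uniformly on the window** (§5–§6 packaged): there are `γ₀ > 0`,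
`c₀ ≥ 0`, `κ > 0` depending on `d`, `ℓ` and the window only such that for every `n ≥ 1`, every admissible
`a_j, m_j², a` and every box, `covOp` is symmetric, `≥ γ₀` as a quadratic form, and has entries
`≤ c₀e^{−κ|y − y′|_∞}`; explicitly `γ₀ = min(min(a₋/(8(d+1)), 1/8)/(ℓ(ℓ+1)/2), a₂₋/L²)`. [folklore] -/
theorem covOp_hyp56 (d ℓ : ℕ) (hℓ : 1 ≤ ℓ) (aminus aplus m2plus a2minus a2plus : ℝ) (ha : 0 < aminus)
    (ha2 : 0 < a2minus) :
    ∃ γ₀ c₀ κ : ℝ, 0 < γ₀ ∧ 0 ≤ c₀ ∧ 0 < κ ∧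
      γ₀ = min (min (aminus / (8 * (d + 1))) (1 / 8) / ((ℓ : ℝ) * (ℓ + 1) / 2)) (a2minus / ((ℓ : ℝ) + 1) ^ 2) ∧
      ∀ (n : ℕ), 1 ≤ n → ∀ (a₁ m2 a₂ : ℝ), aminus ≤ a₁ → a₁ ≤ aplus → 0 ≤ m2 →
        m2 ≤ m2plus → a2minus ≤ a₂ → a₂ ≤ a2plus → ∀ (M' : Fin (d + 1) → ℕ), (∀ i, 1 ≤ M' i) →
          Hyp56 (rho (fun i => (ℓ + 1) * M' i)) (covOp n ℓ a₁ a₂ m2 M') γ₀ c₀ κ := by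
  obtain ⟨κ, C, hκ, hC, hK⟩ := Keff_entry_bound d aminus aplus m2plus ha
  set γ₀ : ℝ := min (min (aminus / (8 * (d + 1))) (1 / 8) / ((ℓ : ℝ) * (ℓ + 1) / 2))
    (a2minus / ((ℓ : ℝ) + 1) ^ 2) with hγ₀
  set c₀ : ℝ := |aplus| + aplus ^ 2 * C + |a2plus| * Real.exp (κ * ℓ) with hc₀
  have hℓ1 : (1 : ℝ) ≤ ℓ := by exact_mod_cast hℓ
  have hP : (0 : ℝ) < (ℓ : ℝ) * (ℓ + 1) / 2 := by positivity
  have hγ : 0 < γ₀ := lt_min (by positivity) (by positivity)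
  have hc : 0 ≤ c₀ := by positivity
  refine ⟨γ₀, c₀, κ, hγ, hc, hκ, rfl, ?_⟩
  intro n hn a₁ m2 a₂ h1 h2 h3 h4 h5 h6 M' hM
  have ha₁ : 0 < a₁ := lt_of_lt_of_le ha h1
  have ha₂ : 0 ≤ a₂ := le_trans ha2.le h5
  have hMℓ : ∀ i, 1 ≤ (ℓ + 1) * M' i := fun i => by nlinarith [hM i]
  refine ⟨covOp_isSymm n ℓ a₁ a₂ m2 M', fun v => ?_, fun p q => ?_⟩
  · have hge := covOp_form_ge hn hℓ ha₁ ha₂ h3 hM v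
    have hγle : γ₀ ≤ min (min (a₁ / (8 * (d + 1))) (1 / 8) / ((ℓ : ℝ) * (ℓ + 1) / 2))
        (a₂ / ((ℓ : ℝ) + 1) ^ 2) := by
      apply min_le_min
      · apply div_le_div_of_nonneg_right _ hP.le
        exact min_le_min (div_le_div_of_nonneg_right h1 (by positivity)) le_rfl
      · exact div_le_div_of_nonneg_right h5 (by positivity)
    have hvv : ∑ p, v p ^ 2 = v ⬝ᵥ v := by
      unfold dotProduct
      exact Finset.sum_congr rfl fun p _ => by ring
    have hvv0 : 0 ≤ v ⬝ᵥ v := by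
      rw [← hvv]
      exact Finset.sum_nonneg fun _ _ => sq_nonneg _
    rw [hvv]
    show γ₀ * (v ⬝ᵥ v) ≤ v ⬝ᵥ (covOp n ℓ a₁ a₂ m2 M').mulVec v
    exact (mul_le_mul_of_nonneg_right hγle hvv0).trans hge
  · unfold rho
    have hKe := hK n hn a₁ m2 h1 h2 h3 h4 (fun i => (ℓ + 1) * M' i) hMℓ p q
    have hPe := blockAvgP_entry_bound ℓ M' hκ.le p q
    have hE := Real.exp_pos (-(κ * supNorm (p.1 - q.1)))
    have hL2 : a₂ / ((ℓ : ℝ) + 1) ^ 2 ≤ |a2plus| :=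
      calc a₂ / ((ℓ : ℝ) + 1) ^ 2 ≤ a₂ := div_le_self ha₂ (one_le_pow₀ (by linarith))
        _ ≤ a2plus := h6
        _ ≤ |a2plus| := le_abs_self _
    have hK2 : a₁ + a₁ ^ 2 * C ≤ |aplus| + aplus ^ 2 * C := by
      have hsq : a₁ ^ 2 ≤ aplus ^ 2 := pow_le_pow_left₀ ha₁.le h2 2
      have habs : a₁ ≤ |aplus| := h2.trans (le_abs_self _)
      nlinarith
    have hentry : covOp n ℓ a₁ a₂ m2 M' p q
        = Keff n a₁ m2 (fun i => (ℓ + 1) * M' i) p q + a₂ / ((ℓ : ℝ) + 1) ^ 2 * blockAvgP ℓ M' p q := by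
      simp only [covOp, Matrix.add_apply, Matrix.smul_apply, smul_eq_mul]
    rw [hentry]
    calc |Keff n a₁ m2 (fun i => (ℓ + 1) * M' i) p q + a₂ / ((ℓ : ℝ) + 1) ^ 2 * blockAvgP ℓ M' p q|
        ≤ |Keff n a₁ m2 (fun i => (ℓ + 1) * M' i) p q| + |a₂ / ((ℓ : ℝ) + 1) ^ 2 * blockAvgP ℓ M' p q| :=
          abs_add_le _ _
      _ ≤ (a₁ + a₁ ^ 2 * C) * Real.exp (-(κ * supNorm (p.1 - q.1)))
          + a₂ / ((ℓ : ℝ) + 1) ^ 2 * (Real.exp (κ * ℓ) * Real.exp (-(κ * supNorm (p.1 - q.1)))) := by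
          refine add_le_add hKe ?_
          rw [abs_mul, abs_of_nonneg (by positivity : (0 : ℝ) ≤ a₂ / ((ℓ : ℝ) + 1) ^ 2)]
          exact mul_le_mul_of_nonneg_left hPe (by positivity)
      _ ≤ (|aplus| + aplus ^ 2 * C) * Real.exp (-(κ * supNorm (p.1 - q.1)))
          + |a2plus| * (Real.exp (κ * ℓ) * Real.exp (-(κ * supNorm (p.1 - q.1)))) :=
          add_le_add (mul_le_mul_of_nonneg_right hK2 hE.le)
            (mul_le_mul_of_nonneg_right hL2 (by positivity))
      _ = c₀ * Real.exp (-(κ * supNorm (p.1 - q.1))) := by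
          rw [hc₀]
          ring

/-- **the lower half of (1.15) for every compression**: `γ₀‖v‖² ≤ ⟨v, (Δ^{(j)}(□) + aL^{-2}P)|_Λ v⟩` with the `γ₀`
of `cov237_box_form_bounds` (the form bound tested on the extension by zero). [folklore] -/
theorem covOpSub_form_ge (d ℓ : ℕ) (hℓ : 1 ≤ ℓ) (aminus aplus m2plus a2minus a2plus : ℝ) (ha : 0 < aminus)
    (ha2 : 0 < a2minus) :
    ∃ γ₀ : ℝ, 0 < γ₀ ∧ ∀ (n : ℕ), 1 ≤ n → ∀ (a₁ m2 a₂ : ℝ), aminus ≤ a₁ → a₁ ≤ aplus → 0 ≤ m2 →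
      m2 ≤ m2plus → a2minus ≤ a₂ → a₂ ≤ a2plus → ∀ (M' : Fin (d + 1) → ℕ), (∀ i, 1 ≤ M' i) →
        ∀ {m : Type*} [Fintype m] (e : m → ↥(boxDom (fun i => (ℓ + 1) * M' i))), Function.Injective e →
          ∀ v : m → ℝ, γ₀ * ∑ i, v i ^ 2 ≤ ∑ i, v i * (covOpSub n ℓ a₁ a₂ m2 M' e).mulVec v i := by
  obtain ⟨γ₀, c₀, κ, hγ, hc, hκ, -, hA⟩ := covOp_hyp56 d ℓ hℓ aminus aplus m2plus a2minus a2plus ha ha2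
  refine ⟨γ₀, hγ, ?_⟩
  intro n hn a₁ m2 a₂ h1 h2 h3 h4 h5 h6 M' hM m _ e he v
  exact (hyp56_submatrix (hA n hn a₁ m2 a₂ h1 h2 h3 h4 h5 h6 M' hM) he).2.1 v

/-- **B4 PROPOSITION 2.3 (1.16) FOR `Ω = □` AND EVERY `Λ ⊆ □^{(j)}`, `A = 0` — HYPOTHESIS-FREE.**  For every dimension
`d + 1`, block size `L = ℓ + 1 ≥ 2` and parameter window there are `δ, c > 0` (the constants of `cov237_box_decay`)
such that for EVERY `n ≥ 1`, every admissible `a_j, m_j², a`, EVERY box `□` built of `L`-blocks and EVERY injection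
`e : m → □^{(j)}` (subset `Λ`): the compression `(Δ^{(j)}(□) + aL^{-2}P)|_Λ` is invertible (so `⁻¹` is the genuine
inverse `C_Λ^{(j)}(□)`) and `|C_Λ^{(j)}(□; e i, e i′)| ≤ c·e^{−δ|e i − e i′|_∞}` for all `i, i′`.  No block structure
of `Λ` is used (at `A = 0` none is needed; nothing is claimed for `A ≠ 0`).
[cite: Balaban1983RegularityDecay, p. 574 Proposition 2.3 (1.16) («|C_Λ^{(k)}(Ω, A; x, x′)| ≤ c₀ exp(−δ₀|x−x′|),
x, x′∈Λ» «for arbitrary Λ ⊂ Ω^{(k)} = Ω∩Z^d, Λ being a sum of big blocks»), p. 573 (1.13) («X|_Λ = ΛXΛ»)] -/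
theorem cov116_box_sub_decay (d ℓ : ℕ) (hℓ : 1 ≤ ℓ) (aminus aplus m2plus a2minus a2plus : ℝ) (ha : 0 < aminus)
    (ha2 : 0 < a2minus) :
    ∃ δ c : ℝ, 0 < δ ∧ 0 < c ∧ ∀ (n : ℕ), 1 ≤ n → ∀ (a₁ m2 a₂ : ℝ), aminus ≤ a₁ → a₁ ≤ aplus → 0 ≤ m2 →
      m2 ≤ m2plus → a2minus ≤ a₂ → a₂ ≤ a2plus → ∀ (M' : Fin (d + 1) → ℕ), (∀ i, 1 ≤ M' i) →
        ∀ {m : Type*} [Fintype m] [DecidableEq m] (e : m → ↥(boxDom (fun i => (ℓ + 1) * M' i))),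
          Function.Injective e →
            covOpSub n ℓ a₁ a₂ m2 M' e * (covOpSub n ℓ a₁ a₂ m2 M' e)⁻¹ = 1 ∧
            ∀ i i' : m, |(covOpSub n ℓ a₁ a₂ m2 M' e)⁻¹ i i'|
              ≤ c * Real.exp (-(δ * supNorm ((e i).1 - (e i').1))) := by
  obtain ⟨γ₀, c₀, κ, hγ, hc, hκ, -, hA⟩ := covOp_hyp56 d ℓ hℓ aminus aplus m2plus a2minus a2plus ha ha2
  have hKn : ∀ a : ℝ, 0 < a → 0 ≤ latticeConst (d + 1) a := fun a ha => latticeConst_nonneg (d + 1) ha.le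
  refine ⟨rate (latticeConst (d + 1)) γ₀ c₀ κ, 2 / γ₀, rate_pos hKn hγ hc hκ, by positivity, ?_⟩
  intro n hn a₁ m2 a₂ h1 h2 h3 h4 h5 h6 M' hM m _ _ e he
  have hAe := hyp56_submatrix (hA n hn a₁ m2 a₂ h1 h2 h3 h4 h5 h6 M' hM) he
  refine ⟨Matrix.mul_nonsing_inv _ ((Matrix.isUnit_iff_isUnit_det _).1 (isUnit_of_hyp56 hγ hAe)), fun i i' => ?_⟩
  exact inv_submatrix_decay hKn hγ hc hκ (rho_isPseudoDist _) (rho_sumBound _)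
    (hA n hn a₁ m2 a₂ h1 h2 h3 h4 h5 h6 M' hM) he i i'

/-- **(1.16) for `Ω = □` and a subset `Λ ⊆ □^{(j)}` given as a `Finset` of unit sites** (the inclusion as the
injection): `Λ(Δ^{(j)}(□) + aL^{-2}P)Λ` is invertible on `ℓ²(Λ)` and `|C_Λ^{(j)}(□; y, y′)| ≤ c·e^{−δ|y − y′|_∞}` for
all `y, y′ ∈ Λ`, with the constants of `cov116_box_sub_decay`.
[cite: Balaban1983RegularityDecay, p. 574 Proposition 2.3 (1.16), p. 573 (1.13)] -/
theorem cov116_box_finset_decay (d ℓ : ℕ) (hℓ : 1 ≤ ℓ) (aminus aplus m2plus a2minus a2plus : ℝ) (ha : 0 < aminus)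
    (ha2 : 0 < a2minus) :
    ∃ δ c : ℝ, 0 < δ ∧ 0 < c ∧ ∀ (n : ℕ), 1 ≤ n → ∀ (a₁ m2 a₂ : ℝ), aminus ≤ a₁ → a₁ ≤ aplus → 0 ≤ m2 →
      m2 ≤ m2plus → a2minus ≤ a₂ → a₂ ≤ a2plus → ∀ (M' : Fin (d + 1) → ℕ), (∀ i, 1 ≤ M' i) →
        ∀ Λ : Finset ↥(boxDom (fun i => (ℓ + 1) * M' i)),
          covOpSub n ℓ a₁ a₂ m2 M' (fun y : ↥Λ => y.1) * (covOpSub n ℓ a₁ a₂ m2 M' (fun y : ↥Λ => y.1))⁻¹ = 1 ∧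
          ∀ y y' : ↥Λ, |(covOpSub n ℓ a₁ a₂ m2 M' (fun y : ↥Λ => y.1))⁻¹ y y'|
            ≤ c * Real.exp (-(δ * supNorm (y.1.1 - y'.1.1))) := by
  obtain ⟨δ, c, hδ, hc, h⟩ := cov116_box_sub_decay d ℓ hℓ aminus aplus m2plus a2minus a2plus ha ha2
  refine ⟨δ, c, hδ, hc, ?_⟩
  intro n hn a₁ m2 a₂ h1 h2 h3 h4 h5 h6 M' hM Λ
  exact h n hn a₁ m2 a₂ h1 h2 h3 h4 h5 h6 M' hM (fun y : ↥Λ => y.1) Subtype.val_injective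

/-- at the whole box (`e = id`) §8 returns (2.37) of §7 with the same constants: the compression along the identity is
`covOp` itself. [folklore] -/
theorem covOpSub_id (n ℓ : ℕ) (a₁ a₂ m2 : ℝ) (M' : Fin (d + 1) → ℕ) :
    covOpSub n ℓ a₁ a₂ m2 M' (id : ↥(boxDom (fun i => (ℓ + 1) * M' i)) → _) = covOp n ℓ a₁ a₂ m2 M' := rfl

/-- non-vacuity at `d + 1 = 4`, `L = 2`, window `a_j ∈ [1/2, 2]`, `m_j² ∈ [0, 1]`, `a ∈ [1/2, 2]`: (1.16) for every
`Finset` `Λ` of unit sites of every box. -/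
example : ∃ δ c : ℝ, 0 < δ ∧ 0 < c ∧ ∀ (n : ℕ), 1 ≤ n → ∀ (a₁ m2 a₂ : ℝ), (1 / 2 : ℝ) ≤ a₁ → a₁ ≤ 2 → 0 ≤ m2 →
    m2 ≤ 1 → (1 / 2 : ℝ) ≤ a₂ → a₂ ≤ 2 → ∀ (M' : Fin (3 + 1) → ℕ), (∀ i, 1 ≤ M' i) →
      ∀ Λ : Finset ↥(boxDom (fun i => (1 + 1) * M' i)),
        covOpSub n 1 a₁ a₂ m2 M' (fun y : ↥Λ => y.1) * (covOpSub n 1 a₁ a₂ m2 M' (fun y : ↥Λ => y.1))⁻¹ = 1 ∧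
        ∀ y y' : ↥Λ, |(covOpSub n 1 a₁ a₂ m2 M' (fun y : ↥Λ => y.1))⁻¹ y y'|
          ≤ c * Real.exp (-(δ * supNorm (y.1.1 - y'.1.1))) :=
  cov116_box_finset_decay 3 1 le_rfl (1 / 2) 2 1 (1 / 2) 2 (by norm_num) (by norm_num)

/-! ## §9  (1.17)–(1.18) for `Ω = □` and every `Λ ⊆ □^{(j)}`: the decay of `δC_Λ^{(j)}(□) = C_Λ^{(j)}(□) − C^{(j)}(□)`
with the distances to `Λᶜ` (v3)

p. 574 (1.17)–(1.18): «Putting δC_Λ^{(k)}(Ω, A) = C_Λ^{(k)}(Ω, A) − C^{(k)}(Ω, A), (1.17) we have also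
|δC_Λ^{(k)}(Ω, A; x, x′)| ≤ c₀ exp(−δ₀(|x−x′| + dist(x, Λ^c) + dist(x′, Λ^c))), x, x′∈Λ. (1.18)».  Here `A = 0`,
`Ω = □`, `Λ` = the range of an injection `e : m → □^{(j)}`, and `dist(·, Λ^c)` is any nonnegative weight `β`
dominated by the sup-distances to the points of `□^{(j)}` off the range (the largest, `distC`, is the sup-distance to
`□^{(j)} ∖ Λ`).  Mechanism: the block-resolvent identity `A_Λ⁻¹ − A⁻¹|_Λ = A_Λ⁻¹·(ΛAΛᶜ)·A⁻¹|_{Λᶜ×Λ}`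
(`B4Sect5Torus.deltaC_eq`) and its decay under (5.6) with the profile bound (`B4Sect5Torus.deltaC_bound` — the
paper's (5.8), proved there by exact block algebra instead of the expansion (5.24)–(5.27)), applied to the
window-uniform (5.6) of `covOp_hyp56` (kernel constant enlarged to `c₀ + 1 > 0`). -/

open B4Sect5Torus (bigC bigC_nonneg deltaC_bound)

/-- (5.6) survives enlarging the kernel constant. [folklore] -/
theorem hyp56_mono {ι : Type*} [Fintype ι] [DecidableEq ι] {ρ' : ι → ι → ℝ} {A : Matrix ι ι ℝ}
    {γ₀ c₀ c₀' δ₀ : ℝ} (h : Hyp56 ρ' A γ₀ c₀ δ₀) (hc : c₀ ≤ c₀') : Hyp56 ρ' A γ₀ c₀' δ₀ :=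
  ⟨h.1, h.2.1, fun p q => (h.2.2 p q).trans (mul_le_mul_of_nonneg_right hc (Real.exp_pos _).le)⟩

/-- **B4 (1.17)–(1.18) FOR `Ω = □`, `A = 0`, EVERY `Λ ⊆ □^{(j)}` — HYPOTHESIS-FREE.**  There are `δ′, c′ > 0`
depending on `d`, `ℓ` and the window only such that for EVERY `n ≥ 1`, every admissible `a_j, m_j², a`, EVERY box,
EVERY injection `e : m → □^{(j)}` (range `Λ`) and EVERY weight `β : m → ℝ` with `0 ≤ β i ≤ |e i − z|_∞` for all
`z ∈ □^{(j)}` off the range (e.g. `β = dist_∞(·, □^{(j)} ∖ Λ)`):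
`|C_Λ^{(j)}(□; e i, e i′) − C^{(j)}(□; e i, e i′)| ≤ c′·e^{−δ′(|e i − e i′|_∞ + β i + β i′)}`.
[cite: Balaban1983RegularityDecay, p. 574 (1.17) («δC_Λ^{(k)}(Ω, A) = C_Λ^{(k)}(Ω, A) − C^{(k)}(Ω, A)»), (1.18)
(«|δC_Λ^{(k)}(Ω, A; x, x′)| ≤ c₀ exp(−δ₀(|x−x′| + dist(x, Λ^c) + dist(x′, Λ^c))), x, x′∈Λ»), p. 594 (5.8)] -/
theorem cov118_box_sub_delta (d ℓ : ℕ) (hℓ : 1 ≤ ℓ) (aminus aplus m2plus a2minus a2plus : ℝ) (ha : 0 < aminus)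
    (ha2 : 0 < a2minus) :
    ∃ δ c : ℝ, 0 < δ ∧ 0 < c ∧ ∀ (n : ℕ), 1 ≤ n → ∀ (a₁ m2 a₂ : ℝ), aminus ≤ a₁ → a₁ ≤ aplus → 0 ≤ m2 →
      m2 ≤ m2plus → a2minus ≤ a₂ → a₂ ≤ a2plus → ∀ (M' : Fin (d + 1) → ℕ), (∀ i, 1 ≤ M' i) →
        ∀ {m : Type*} [Fintype m] [DecidableEq m] (e : m → ↥(boxDom (fun i => (ℓ + 1) * M' i))),
          Function.Injective e → ∀ β : m → ℝ, (∀ i, 0 ≤ β i) →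
            (∀ i (z : ↥(boxDom (fun i => (ℓ + 1) * M' i))), (¬ ∃ j, e j = z) → β i ≤ supNorm ((e i).1 - z.1)) →
              ∀ i i' : m, |(covOpSub n ℓ a₁ a₂ m2 M' e)⁻¹ i i' - (covOp n ℓ a₁ a₂ m2 M')⁻¹ (e i) (e i')|
                ≤ c * Real.exp (-(δ * (supNorm ((e i).1 - (e i').1) + β i + β i'))) := by
  obtain ⟨γ₀, c₀, κ, hγ, hc, hκ, -, hA⟩ := covOp_hyp56 d ℓ hℓ aminus aplus m2plus a2minus a2plus ha ha2
  have hKn : ∀ a : ℝ, 0 < a → 0 ≤ latticeConst (d + 1) a := fun a ha => latticeConst_nonneg (d + 1) ha.le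
  have hc1 : 0 < c₀ + 1 := by linarith
  have hB := bigC_nonneg hKn hγ hc1.le hκ (K := latticeConst (d + 1))
  refine ⟨rate (latticeConst (d + 1)) γ₀ (c₀ + 1) κ / 4, bigC (latticeConst (d + 1)) γ₀ (c₀ + 1) κ + 1,
    by have := rate_pos hKn hγ hc1.le hκ; positivity, by positivity, ?_⟩
  intro n hn a₁ m2 a₂ h1 h2 h3 h4 h5 h6 M' hM m _ _ e he β hβ0 hβ i i'
  have hA' := hyp56_mono (hA n hn a₁ m2 a₂ h1 h2 h3 h4 h5 h6 M' hM) (by linarith : c₀ ≤ c₀ + 1)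
  have h := deltaC_bound hKn hγ hc1 hκ (rho_isPseudoDist _) (rho_sumBound _) hA' he hβ0
    (fun i z hz => by show β i ≤ supNorm ((e i).1 - z.1); exact hβ i z hz) i i'
  refine h.trans ?_
  exact mul_le_mul_of_nonneg_right (le_add_of_nonneg_right zero_le_one) (Real.exp_pos _).le

/-- `dist(y, Λ^c)` for `Λ ⊆ □^{(j)}`: the sup-distance from `y` to the complement of `Λ` INSIDE the unit box
(`inf ∅ = 0` when `Λ = □^{(j)}`). [cite: Balaban1983RegularityDecay, p. 574 (1.18) («dist(x, Λ^c)»), dictionary] -/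
def distC {N : Fin (d + 1) → ℕ} (Λ : Finset ↥(boxDom N)) (y : ↥(boxDom N)) : ℝ :=
  sInf ((fun z : ↥(boxDom N) => supNorm (y.1 - z.1)) '' {z | z ∉ Λ})

/-- `dist(y, Λ^c) ≥ 0`. [folklore] -/
theorem distC_nonneg {N : Fin (d + 1) → ℕ} (Λ : Finset ↥(boxDom N)) (y : ↥(boxDom N)) : 0 ≤ distC Λ y := by
  unfold distC
  apply Real.sInf_nonneg
  rintro _ ⟨z, -, rfl⟩
  exact supNorm_nonneg _

/-- `dist(y, Λ^c) ≤ |y − z|_∞` for every `z ∉ Λ`. [folklore] -/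
theorem distC_le {N : Fin (d + 1) → ℕ} (Λ : Finset ↥(boxDom N)) (y : ↥(boxDom N)) {z : ↥(boxDom N)}
    (hz : z ∉ Λ) : distC Λ y ≤ supNorm (y.1 - z.1) := by
  unfold distC
  exact csInf_le ⟨0, by rintro _ ⟨w, -, rfl⟩; exact supNorm_nonneg _⟩ ⟨z, hz, rfl⟩

/-- **(1.17)–(1.18) for `Ω = □`, `A = 0` and a subset `Λ ⊆ □^{(j)}` given as a `Finset` of unit sites**, with the
printed weight `dist(·, Λ^c)` (typed `distC`, complement inside the unit box):
`|C_Λ^{(j)}(□; y, y′) − C^{(j)}(□; y, y′)| ≤ c′·e^{−δ′(|y − y′|_∞ + dist(y, Λ^c) + dist(y′, Λ^c))}`, `y, y′ ∈ Λ`.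
[cite: Balaban1983RegularityDecay, p. 574 (1.17)–(1.18)] -/
theorem cov118_box_finset_delta (d ℓ : ℕ) (hℓ : 1 ≤ ℓ) (aminus aplus m2plus a2minus a2plus : ℝ) (ha : 0 < aminus)
    (ha2 : 0 < a2minus) :
    ∃ δ c : ℝ, 0 < δ ∧ 0 < c ∧ ∀ (n : ℕ), 1 ≤ n → ∀ (a₁ m2 a₂ : ℝ), aminus ≤ a₁ → a₁ ≤ aplus → 0 ≤ m2 →
      m2 ≤ m2plus → a2minus ≤ a₂ → a₂ ≤ a2plus → ∀ (M' : Fin (d + 1) → ℕ), (∀ i, 1 ≤ M' i) →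
        ∀ Λ : Finset ↥(boxDom (fun i => (ℓ + 1) * M' i)), ∀ y y' : ↥Λ,
          |(covOpSub n ℓ a₁ a₂ m2 M' (fun y : ↥Λ => y.1))⁻¹ y y' - (covOp n ℓ a₁ a₂ m2 M')⁻¹ y.1 y'.1|
            ≤ c * Real.exp (-(δ * (supNorm (y.1.1 - y'.1.1) + distC Λ y.1 + distC Λ y'.1))) := by
  obtain ⟨δ, c, hδ, hc, h⟩ := cov118_box_sub_delta d ℓ hℓ aminus aplus m2plus a2minus a2plus ha ha2
  refine ⟨δ, c, hδ, hc, ?_⟩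
  intro n hn a₁ m2 a₂ h1 h2 h3 h4 h5 h6 M' hM Λ y y'
  refine h n hn a₁ m2 a₂ h1 h2 h3 h4 h5 h6 M' hM (fun y : ↥Λ => y.1) Subtype.val_injective
    (fun y : ↥Λ => distC Λ y.1) (fun y => distC_nonneg Λ y.1) (fun w z hz => distC_le Λ w.1 ?_) y y'
  intro hzΛ
  exact hz ⟨⟨z, hzΛ⟩, rfl⟩

/-- non-vacuity at `d + 1 = 4`, `L = 2`, window `a_j ∈ [1/2, 2]`, `m_j² ∈ [0, 1]`, `a ∈ [1/2, 2]`: (1.18) for every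
`Finset` `Λ` of unit sites of every box. -/
example : ∃ δ c : ℝ, 0 < δ ∧ 0 < c ∧ ∀ (n : ℕ), 1 ≤ n → ∀ (a₁ m2 a₂ : ℝ), (1 / 2 : ℝ) ≤ a₁ → a₁ ≤ 2 → 0 ≤ m2 →
    m2 ≤ 1 → (1 / 2 : ℝ) ≤ a₂ → a₂ ≤ 2 → ∀ (M' : Fin (3 + 1) → ℕ), (∀ i, 1 ≤ M' i) →
      ∀ Λ : Finset ↥(boxDom (fun i => (1 + 1) * M' i)), ∀ y y' : ↥Λ,
        |(covOpSub n 1 a₁ a₂ m2 M' (fun y : ↥Λ => y.1))⁻¹ y y' - (covOp n 1 a₁ a₂ m2 M')⁻¹ y.1 y'.1|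
          ≤ c * Real.exp (-(δ * (supNorm (y.1.1 - y'.1.1) + distC Λ y.1 + distC Λ y'.1))) :=
  cov118_box_finset_delta 3 1 le_rfl (1 / 2) 2 1 (1 / 2) 2 (by norm_num) (by norm_num)

end

end Literature.MathematicalPhysics.QuantumFieldTheory.Balaban1983to89.B4BoxCov237
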